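import Summits.QuantumAdvantage.QuantumAdvantage.Theses.WhiteBoxWalk
import Literature.Computability.QuantumComplexity.GluedTreesThm9Graph
import Literature.Computability.Cryptography.IndistinguishabilityObfuscatorSubexp
import Literature.Computability.Cryptography.PuncturablePRF
import Literature.Computability.Complexity.RandomizedProofs
import Literature.Computability.Complexity.PCPProofs
import Literature.Computability.Cryptography.GGM
import Literature.Computability.Complexity.StringSwap

/-!
# Disproof of `WbwObfuscatedGluedTrees` — standing-disprover work file (crux `stmt-QuantumAdvantage-2340`, route `WhiteBoxWalk`)

The crux is INFORMAL (no `def WbwObfuscatedGluedTrees : Prop` in the route file yet; the generator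
`obfuscatedGluedTreesGen` is an open definition request). Informal claim: *if `iO` is
`(2^{λ^ε}, 2^{-λ^ε})`-secure for `P/poly`, `F` is a puncturable PRF and injective OWFs of the same
security exist, then for the generator `gen s = (iO(N_k), name_k(ENTRANCE))`, `ans s = name_k(EXIT)`
(obfuscated neighbour circuit of the glued-trees graph `G'_n` with authenticated-encryption vertex
names) clause (C) of `WbwThesis` holds: every PPT finds `name_k(EXIT)` with negligible probability.*

## Findings (cycle 1, `refuter-cdisprove-stmt-QuantumAdvantage-2340-0`, 2026-08-16) — all theorems below are `sorry`-free

* §0 `ClauseC`, `wbwThesis_iff` (`Iff.rfl`: the crux is ONE conjunct of the thesis for ONE witness,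
  under extra hypotheses — it does not restate the target), `CruxShape obfGen` = the typed shape the
  planner's signature will have once `obfuscatedGluedTreesGen` lands.
* §0 WHY NO UNCONDITIONAL `¬` CAN EVER BE LANDED: `cruxShape_of_no_subexpIO`,
  `cruxShape_of_no_injectiveOWF`, `not_cruxShape_imp`: a Lean proof of `¬ CruxShape obfGen` proves
  `SubexpIOExist ε` for some `ε ∈ (0,1)` AND the existence of an injective one-way function (hence
  `NP ⊄ BPP`). So the refuter lane for this crux is necessarily "negative lemma modulo
  H = (subexp iO ∧ injective OWF ∧ (t,δ)-PPRF exist)", and modulo H a kill is exactly a UNIVERSAL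
  white-box EXIT-finder (an attack on `O(N_k)` valid for one sub-exp iO `O` transfers to every other
  one `O'` by obfuscating `O'(N_k)` once more and using that EXIT is publicly verifiable,
  `degree_eq_two_iff`). None is known; under the ideal-obfuscation heuristic (JLLW 2023, pseudorandom
  oracle model) white-box = black-box and (C) follows from ChildsEtAl2003 Thm 9. VERDICT: resists.
* §0b TYPED TRAP `clauseC_false_of_ans_nil_frequently`: if on infinitely many seed lengths every
  seed gets the empty answer (a generator that parses `s = (k, coins)` only at special lengths and
  defaults to `[]`), clause (C) is FALSE — the coin-free constant algorithm `[]` (PPT by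
  `PolyTimeComputable.const` + `IsPolyTime.ofDet_holds`) wins with probability 1 there. The typed
  generator must stretch EVERY seed of EVERY length (PRG/KDF) and never default `ans`.
* §1 LOAD-BEARING HYPOTHESIS "canonical order of the adjacency list" (`RoleOrder`): if `N_k` lists
  neighbours in ROLE order (parent | children | glued) instead of sorted order, the maps `parentV`,
  `childV`, `cross₁` become available at the name level and `roleWalk_eq_exit` finds EXIT in `2n+1`
  evaluations with probability 1 (`descend`/`ascend` are walks IN the graph: `adj_childV`,
  `adj_parentV`, `adj_cross₁`). Any typed statement must fix the sorted order of `gluedTreesOracle`.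
* §1b LOAD-BEARING HYPOTHESIS "names hide the depth" (`DepthLeak`): the parent is the UNIQUE
  strictly shallower neighbour (`eq_parentV_of_adj_of_depth_lt`), so any efficiently decidable
  "which of two adjacent names is shallower" predicate (name format/length, visible level tag or
  level-indexed key, `r`-collisions with known labels) turns the climb into the role walk: EXIT in
  `2n+1` moves. Bears on the planner's "level-indexed PRFs" repair: the level must stay invisible.
* §2 LOAD-BEARING HYPOTHESIS "ciphertext integrity of names" (`Malleable`): for the item's example
  scheme `name = (r, F(r) ⊕ label, tag)` with the tag / `r = F''(label)` re-check DROPPED, the string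
  `forge name(ENTRANCE) = (r_E, c_E ⊕ label(ENTRANCE) ⊕ label(EXIT))` is computed from public data and
  decodes to EXIT (`dec_forge`); one evaluation of the neighbour circuit on it returns EXIT's children,
  one more returns the canonical `name(EXIT)` among three names, and the public degree-2 test
  (`degree_eq_two_iff`, `eq_exit_of_adj_child_exit`) singles it out: canonical `ans s` in ≤ 5
  evaluations, probability 1. Any typed statement must build "reject unless canonical" into `N_k`.
* §3 OBSTRUCTION TO THE ONLY NAMED PROOF TEMPLATE (BPR15 plant-and-grow), formal core
  (`Percolation`): the growth rule "a name may be punctured once every circuit input that PRODUCES it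
  is dead" is, for an undirected neighbour circuit, bootstrap percolation with threshold = degree; its
  closure is reached in ONE round and equals `S ∪ {v | N(v) ⊆ S}` (`oneRound_isGrowthClosed`,
  `oneRound_subset_of_isGrowthClosed`, `sInter_isGrowthClosed_eq_oneRound`; sequential form
  `killed_iff_mem_oneRound` for the inductive `Killed`); for `G'_n`:
  `exit_mem_oneRound_iff` — un-naming EXIT forces a plant at EXIT itself or at BOTH children of EXIT,
  i.e. at publicly labelled positions adjacent to the answer. Contrast `line_cascade`: on BPR's
  directed line (unique producer) one plant kills the whole tail. This is the formal half of the
  route's kill criterion (b); the informal half (plants at public labels are unaffordable for a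
  key-holding reduction: BCP14/Lemma 5.1 needs the differing input hidden from the sampler's view) is
  in the previous attacker's ATTACK.md §3 and ideator-1's BARRIER-NOTES B1–B2 (not readable from this
  seat; cited from the item notes).
* §4 Remarks (docstrings only): identity obfuscator kills "(C) for every functionality-preserving
  obfuscator" (keys in the clear); seed budget `|s| = n` vs `λ = n^c` (T2 of the previous attack) is a
  typing repair (`depth = ⌊n^{1/a}⌋`), not a kill; public (non-pseudorandom) cycle `σ`: no attack found
  (orientation near the glue becomes detectable via 4-cycles but climbing the EXIT tree still costs
  `2^{n-j}` look-ahead per level — recorded as NOT load-bearing for truth, only for the CCDFGS proof).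

## Findings (cycle 2, `refuter-cdisprove-stmt-QuantumAdvantage-2340-g2-0`, 2026-08-16) — `sorry`-free

* STATUS UNCHANGED: the crux is still informal (`obfuscatedGluedTreesGen` not landed), so there is no
  `¬`-target; `not_cruxShape_imp` (§0) still rules out an unconditional refutation of the typed shape.
* §1c NEW LOAD-BEARING HYPOTHESIS "no complete layer is recognisable" (`Altimeter`, generalises §1b):
  if any efficiently decidable predicate on names satisfies `{depth = m, side of x} ⊆ R ⊆ {depth ≥ m-1}`
  for ONE layer `m`, then at a vertex entered from a known child the parent is told from the other
  child by ONE arbitrary non-backtracking walk of `m - j - 1` steps (`forced_descent`: from a child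
  every such walk goes down and ends at depth exactly `m`; `depth_walk_le`: from the parent it ends
  at depth `≤ m - 2`; `altimeter`: the dichotomy). EXIT in `O(n²)` evaluations, probability 1.
  Bears on "level-indexed keys", visible level tags, and on every REDUCTION owning a layer key
  (ideator 2, B2): such a party is never a legitimate stand-in for the adversary.
* §1d NEW LOAD-BEARING HYPOTHESIS "the alternating cycle is (pseudo)random" — cycle 1 §4 had "public
  `σ`: no attack found". Sharpened: STRUCTURE, not publicity, is what kills. For the structured datum
  `σ₀ = (id, id)` (a legitimate `G'_n`; the quantum walk is `σ`-independent) the glue edges put every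
  vertex of the bottom two layers on a 4-cycle and no other vertex (`onSquare_σ₀_iff`; the half
  `not_onSquare_of_depth_add_two_le` holds for EVERY `σ`), the square test costs 4 evaluations, so it
  is an altimeter and it orients the walker where it enters the EXIT tree — stated for ANY cycle
  datum whose glue puts the bottom two layers on squares (`altimeter_of_bottom_squares`,
  `orientation_pred_of_bottom_squares`, `leaf_orientation_of_bottom_squares`; `σ₀_altimeter`,
  `σ₀_orientation_pred`, `σ₀_leaf_orientation` are the corollaries); the climb ends at EXIT
  (`iterate_parentV_leafR_eq_exit`). EXIT with probability 1 in `≤ n² + 10n + 30` evaluations on every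
  such instance, obfuscated or not (simulation: kit job j010027, n ≤ 20: e.g. 124 evaluations at
  n = 13; the same walker fails at the first orientation step on random cycles). So the PRP key of the
  cycle is as sensitive as the naming keys, no hybrid may trade the pseudorandom cycle for a
  structured one, and "bottom squares" is a concrete sufficient condition for classical collapse;
  ChildsEtAl2003 Thm 9 visibly needs its random cycle.
* §5 `QuantumShadow.no_erasing_terminal` (telescoping; ideator 2 §A): a chain of black-box-in-`A`
  reductions to post-quantum-possible assumptions bounds the quantum walker too, hence cannot end in
  an answer-free world — the hypotheses AS STATED (generic subexp iO + injective OWF + PPRF) resist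
  PROOF by every standard iO technique; not evidence of falsity.
* Literature (cycle 2): see §4 (sweep re-run when searchd is reachable; cycle-1 sweep was degraded).
* §4 (cycle 2) QUANTIFIER-ORDER OBLIGATION for keyed hybrid steps under the tree's iO notion
  (`D`, advice fixed before the pair; no key given to `D`): resolved by worst-case-key advice —
  LANDED as `Negative/KeyedIndistinguishability.lean` (`IsSecureIndistinguishable.keyed_family`,
  `keyed_family_subexp`, `ioAdvantageAdv_congr_advice`; p76277): the `(t,δ)` bound holds eventually
  for ALL keys of a keyed family of admissible pairs at once.
* LANDED this cycle (all ACCEPTED): p75397 `Negative/Altimeter.lean` (§1b DepthLeak, §1c Altimeter,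
  §1d general half `Squares`), p75807 `Negative/StructuredCycle.lean` (§1d: `σ₀`, bottom squares),
  p75637 `Negative/TypedTraps.lean` (§0b, self-contained on the route vocabulary), p75651
  `Negative/GrowthSequences.lean` (§3: `Killed`, `killed_iff_mem_oneRound`, `killed_exit_iff`),
  p76277 `Negative/KeyedIndistinguishability.lean` (§4). With cycle 1's p73147 `GrowthClosure.lean`
  and p73154 `LoadBearing.lean`, every theorem of this file except §5's two telescoping lemmas now
  has an importable twin under `Theorems/WbwObfuscatedGluedTrees/Negative/`.
* VERDICT cycle 2: no kill. Resists disproof because a kill = a universal white-box EXIT-finder for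
  canonical SIV names + pseudorandom cycle (none known; secure in ideal-obfuscation models); resists
  proof because of §3 (percolation) + §5 (quantum shadow).

## Findings (cycle 3, `refuter-cdisprove-stmt-QuantumAdvantage-2340-g3-0`, 2026-08-16) — `sorry`-free

* Re-armed at "skeleton registered": `Lines/knowledge-of-walk-split.lean` (stubs `stub_split`,
  `stub_obfuscationMonotone`, `stub_bestPossibleStep`; target `KnowledgeTransfer`; bridge
  `cruxShape_of_knowledgeTransfer`). The crux itself is still informal: no `¬`-target, §0 stands.
* §6 `Targets` (NEW): the skeleton's objects copied verbatim and attacked.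
  (T-b) `not_admissible_of_coinLen_pos` / `coinClause_unsatisfiable_of_coinLen_pos` / `hadm_unsatisfiable` /
  `admissible_forces_sublinear_kappa`: the coin discipline `∀ s, O.coins (κ |s|) (C_b k) ≤ |s| − h |s|` forces
  a ZERO coin budget at `s = []`; every obfuscator tossing a coin on every input is admissible for no line
  datum, both iO stubs are VACUOUS for it, and the bridge's `hadm` (all sub-exp iO, `O`-independent datum) is
  unsatisfiable whenever a sub-exp iO exists at all — UNCONDITIONALLY: `CoinPad.padCoin_isSubexpIO` (one
  ignored coin keeps `IsSubexpIO`) gives `cruxShape_of_hadm : hadm → CruxShape obfGen` for EVERY generator,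
  i.e. the bridge's admissibility hypothesis alone implies its conclusion. stub-misstated;
  repair: eventual coin clause + `O`-dependent line datum (or PRG-stretched seed).
  (T-a) `stub_bestPossibleStep` / `LineData` have no length bound on `nm`, `ans`; padding `nm` to length
  `2^{Q(n)}` out-runs every admissible iO distinguisher, and under the crux's own hypotheses (sub-exp iO +
  sub-exp injective OWF ⇒ dead-code-leaky sub-exp iO) the coin-repaired stub is FALSE (world 1
  information-theoretic: `uniformProb_prefix_le`; world 0: brute-force opening). stub-misstated; repair:
  `|nm k|, |ans k| ≤ poly(n)` (drefute concurs independently; `|ans|` bound optional). `stub_split`: true as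
  typed (drefute: proved, `StubSplitProof.lean`). `stub_obfuscationMonotone`: true for poly-length clear
  instances; AS FILED shown false ON PAPER in the `RandAlg` model by the drefute seat (length-indexed
  coin-budget advice, Lean-certified, + superpolynomial clear code length + a paper-only diagonal answer
  table; repair `|genClear … s| ≤ q(|s|)`) — same root as (T-a).
  (T-d) remark: the reference obfuscator `O₀` of the antecedents KWA₀/WordHard₀ can only be typed
  EXISTENTIALLY (`∀O₀` gadget-false, `O₀ := O` forbidden, a closed key-hiding `O₀` from `(P,f,c)` unavailable).
* VERDICT cycle 3: no kill of the crux (still informal; §0 stands); the picked line's bridge is vacuous as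
  typed (`cruxShape_of_hadm`, unconditional) and its hardest stub is mis-typed (T-a); both repairs are cheap
  and stated; reported to the lead (evidence notes `stub-misstated: …`, `NegativeNote-*.md`).

## Findings (cycle 4, `refuter-cdisprove-stmt-QuantumAdvantage-2340-g4-0`, 2026-08-16) — `sorry`-free

* Re-armed after the lead's RESHAPE of the line (skeleton sha `34fbd87f…`, `Lines/knowledge_of_walk_split.lean`,
  2026-08-16T05:20Z): (T-b) the coin discipline of `Admissible` / stubs 2–3 is now EVENTUAL (`∃ n₀, ∀ s, n₀ ≤ |s| → …`)
  and the bridge takes an `O`-DEPENDENT datum `𝓛 O P f c`; (T-a) clear instances, names and answers are poly-length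
  (`∃ q, ∀ s, |genClear … C₀ …| + |genClear … C₁ …| + |keyed h ans s| ≤ q |s|`). AUDIT OF THE RESHAPE (§7): the `s = []`
  witness and the coin-padding refutation of `hadm` are gone (for each `O` the datum may shrink its schedule below
  `O`'s coin polynomial: `κ n = ⌊n^{1/(2D)}⌋`, depth `n^{Θ(1/D)}`, still super-logarithmic, so Thm 9's `4·2^{-d/6}`
  stays negligible); the advice `(1ⁿ, nm k, ans k)` of the keyed hybrid is poly-length; `stub_split` unchanged (proved
  by the drefute seat), `stub_obfuscationMonotone` / `stub_bestPossibleStep` now have exactly the repaired signatures of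
  §6 `Repaired` — no attack on any of the three as RE-typed; the composition `WbwObfuscatedGluedTrees_of` is by name and
  correct. The crux itself is still informal: no `¬`-target, §0 stands.
* §6's verbatim copies are those of the SUPERSEDED skeleton (sha `17df6c6a…`); its (T-b)/(T-a) theorems are filed as
  `Negative/CoinPadding.lean` (VI-a, definition-free: `isSubexpIO_padCoin`, `subexpIOExist_iff_pos_coins`,
  `coinClause_unsatisfiable_of_coinLen_pos`, `exists_subexpIO_pointwise_coinClause_false`, `uniformProb_prefix_le`) and
  `Negative/CoinDiscipline.lean` (VI-b: `PointwiseLine.LineData/Admissible`, `cruxShape_of_hadm`) — proposal ids in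
  the HANDOFF of the seat's NOTES (gate intermittently unreachable this cycle).
* §7 (NEW) two typing obligations the reshape does not address, both for the DEFINITION item / planner, neither a kill:
  (T8) **`gen ∈ FP` needs a COMPUTABLE coin budget.** `genObf` cuts the obfuscator's coins off the seed with
  `take (O.coins (κ n) (C k))`, and `O.coins = O.coinLen ∘ |encodeInput|` is, under `O.IsEfficient`
  (`= RandAlg.IsPolyTime`: "`coinLen` polynomially BOUNDED", `Randomized.lean`), an ARBITRARY poly-bounded function —
  not computable in general (the same decoupling of `run` and `coinLen` that gives the coin-length advice channel of
  `Negative/CoinLengthAdvice.lean`). Hence `PolyTimeComputable id id (𝓛.gen O)` — the FIRST conjunct of `WbwThesis`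
  for the route's witness `obfGen O P f c = (𝓛.gen O, 𝓛.answer)` (bridge `hgen`) — is NOT derivable from
  `IsSubexpIO ε ppolyCircuits O`, whatever the datum; and nothing inside the model repairs it: functionality and
  security constrain `obf κ C r` only at `|r| = coins κ C` (off-budget coin strings are unconstrained, so feeding the
  whole seed tail, or a guessed prefix, forfeits perfect functionality, hence clause (Q) "for EVERY seed"), while any
  re-budgeting à la `padCoin` needs `coins` itself. `CruxShape`/clause (C) are unaffected (hardness of a
  non-computable ensemble is meaningful); the THESIS needs, in the tree, the hypothesis "a sub-exp iO WITH a
  polynomial-time computable (w.l.o.g. polynomial, `coinLen = p.eval`) coin schedule exists" — automatic in print (a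
  PPT's coin usage is read off its transcript), an extra conjunct here. Record for the planner's eventual signature of
  the crux / of `obfuscatedGluedTreesGen`: quantify `∀ O, IsSubexpIO ε ppolyCircuits O → (O.coinLen computable) → …`
  or carry the coin polynomial as a parameter of the generator.
  (T-d′) **the reference-obfuscator dilemma survives the reshape, sharpened.** Now that the datum sees `O`, the one
  CLOSED choice of the reference family that types — `C₁ k̃ := pad_S (O.obf κ₀ N_k r₀)` with the universally
  quantified `O` — turns the bridge's `hKW` into `∀ O sub-exp iO, KWA(genClear (O-obfuscated N_k))`, i.e. the `∀O`-KWA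
  that the gadget obfuscator of TRIAGE-r1-3 / §4 (cycle 3, gadget boundary) makes inconsistent with
  (iO ∧ PRF ∧ hidden-endpoint path hardness); an `O`-independent `C₁` needs a closed key-hiding `O₀`, which the tree
  does not have. So the antecedents must be typed EXISTENTIALLY in `O₀` (cycle 3 (T-d)), and the definition item must
  NOT instantiate `C₁` with the quantified `O`. In print the nearest statement is Bitansky–Canetti–Paneth–Rosen,
  *On the existence of extractable one-way functions* (SIAM J. Comput. 2016, doi:10.1137/140975048; `lit read`,
  materialised pp. 13–15): Theorem 9 (p. 13) "Assuming IO for all circuits, neither EOWFs nor GEOWFs exist, with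
  respect to common auxiliary input of unbounded polynomial length"; the proof (§4.3.1–4.3.2, pp. 13–14) is VERBATIM
  the gadget pattern — a universal adversary "parses `z` as a circuit and returns `z(e)`", `z` = an obfuscated padded
  circuit applying a puncturable PRF and then the function — and Remark 6 (p. 13) records that "benign" auxiliary-input
  distributions (e.g. uniform) are NOT ruled out: exactly the tier of KWA₀ for one honest `O₀` (benign instance
  distribution) versus the `∀O`-KWA (adversarial code in the instance).
  (M) **the walk model is free data.** `LineData.M` is constrained only by `Coherent`; for the EDGELESS model
  (`nbrs x y = some []`: every string valid, only `[]` has an endpoint) `WordHard` holds vacuously (empty event) and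
  `KnowledgeOfWalk` FAILS by the skeleton's own `not_knowledgeOfWalk_of_unreachable` (the constant adversary `[]`);
  for the model "valid = {entrance, answers}" KWA degenerates to clause (C) itself and the split to `(C) → (C)`. So
  `KnowledgeTransfer` quantifies over data for most of which its antecedents are false or trivial — harmless for the
  line (antecedents are hypotheses), but the route-level obligations `hcoh`/`hKW` mean something only for the
  EVALUATING model `M_eval` (nbrs = run the instance's code); the definition item should fix `M := M_eval` by
  construction, not leave it a field.
* Literature (cycle 4): searchd rc 75 at session start (4th consecutive cycle); retried later in the cycle — see §4.
* VERDICT cycle 4: no kill. The reshaped line is sound as typed (three true reductions); the crux's content sits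
  entirely in the existentially-typed antecedents KWA₀ ∧ WordHard₀ for one honest reference obfuscator, plus the
  definitional obligations (T8, `M := M_eval`, poly schedule); a disproof modulo H remains = a universal white-box
  EXIT-finder (§4), none known.

Prose lives in docstrings; every `theorem` here is checked (`lean check` rc 0, 0 sorries).
-/

set_option linter.dupNamespace false

namespace Summit.QuantumAdvantage.QuantumAdvantage.Cruxes.WbwObfuscatedGluedTrees.Disproof

open Literature.Computability.Cryptography Literature.Computability.Complexity
open Literature.Computability.QuantumComplexity
open Filter Asymptotics

/-! ## §0 The typed shape of the informal crux, and why `¬` cannot be unconditional -/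

/-- Clause (C) of `WbwThesis` for a fixed generator/answer pair `(gen, ans)`: every PPT `A`, given
`(1ⁿ, gen s)` for uniform `s ∈ {0,1}ⁿ`, outputs a string with prefix `ans s` with probability
decaying superpolynomially in `n`. Verbatim sub-formula of the route decl. -/
def ClauseC (gen ans : List Bool → List Bool) : Prop :=
  ∀ A : RandAlg (List Bool) (List Bool), IsPPT A id →
    SuperpolynomialDecay atTop (fun n : ℕ => (n : ℝ)) (fun n : ℕ =>
      uniformAvg n fun s => A.pr id (boolPair (Computability.unaryEncodeNat n) (gen s)) {y | ans s <+: y})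

/-- Restates-the-target check: the thesis is `∃ gen ans, FP ∧ length ∧ (Q) ∧ ClauseC gen ans`
definitionally; the crux asserts `ClauseC` for ONE specific pair under EXTRA hypotheses, so it is a
proper sub-goal, not the target in other words. -/
theorem wbwThesis_iff :
    Summit.QuantumAdvantage.QuantumAdvantage.Theses.WhiteBoxWalk.WbwThesis ↔
      ∃ (gen ans : List Bool → List Bool), PolyTimeComputable id id gen ∧
        (∃ p : Polynomial ℕ, ∀ s, (ans s).length = p.eval (gen s).length) ∧
        (∃ F : QCircuitFamily cliffordT, F.IsOracleFree ∧ F.IsUniform ∧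
          ∀ s, 2 / 3 ≤ F.kernelProb 0 (gen s) {y | ans s <+: y}) ∧ ClauseC gen ans :=
  Iff.rfl

/-- The type of the missing definition `obfuscatedGluedTreesGen`: from an obfuscator `O`, a
puncturable-PRF scheme `P`, an injective one-way function `f` and the exponent `c` (`λ = n^c`) it
must produce the pair `(gen, ans)`. (Typing obligation T1 of the previous attack: the primitives are
FED to the generator; the existential `SubexpIOExist` cannot parametrise a fixed `gen`.) -/
abbrev GenType : Type :=
  CircuitObfuscator → PuncturablePRFScheme → (List Bool → List Bool) → ℕ →
    (List Bool → List Bool) × (List Bool → List Bool)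

/-- `CruxShape obfGen`: the typed shape of the crux once the generator lands — for every
`ε ∈ (0,1)`, every `(2^{κ^ε}, 2^{-κ^ε})`-secure iO `O` for `P/poly`, every `(2^{κ^ε}, 2^{-κ^ε})`-secure
puncturable PRF `P`, every injective one-way `f` and every `c` with `c·ε > 1` (BPR15 §5.1
parameters; T3), clause (C) holds for `obfGen O P f c`. -/
def CruxShape (obfGen : GenType) : Prop :=
  ∀ ε : ℝ, 0 < ε → ε < 1 → ∀ O : CircuitObfuscator, IsSubexpIO ε ppolyCircuits O →
    ∀ P : PuncturablePRFScheme,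
      IsTDSecurePuncturablePRF P (fun κ => (2 : ℝ) ^ ((κ : ℝ) ^ ε))
        (fun κ => (2 : ℝ) ^ (-((κ : ℝ) ^ ε))) →
      ∀ f : List Bool → List Bool, IsOneWay f → Function.Injective f →
        ∀ c : ℕ, 1 < (c : ℝ) * ε → ClauseC (obfGen O P f c).1 (obfGen O P f c).2

/-- If sub-exponentially secure iO does not exist for any `ε ∈ (0,1)`, the crux holds VACUOUSLY,
whatever the generator. -/
theorem cruxShape_of_no_subexpIO (obfGen : GenType)
    (h : ∀ ε : ℝ, 0 < ε → ε < 1 → ¬ SubexpIOExist ε) : CruxShape obfGen := by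
  intro ε hε hε1 O hO
  exact absurd ⟨O, hO⟩ (h ε hε hε1)

/-- If injective one-way functions do not exist, the crux holds VACUOUSLY. -/
theorem cruxShape_of_no_injectiveOWF (obfGen : GenType)
    (h : ∀ f : List Bool → List Bool, IsOneWay f → ¬ Function.Injective f) : CruxShape obfGen := by
  intro ε _ _ O _ P _ f hf hinj
  exact absurd hinj (h f hf)

/-- **Why no unconditional refutation can be landed.** A proof of `¬ CruxShape obfGen` yields, in
particular, a sub-exponentially secure iO for `P/poly` (for some `ε ∈ (0,1)`), a `(t,δ)`-secure
puncturable PRF and an injective one-way function — each an unproved cryptographic existence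
statement (the last one implies `NP ⊄ BPP`). Hence the refuter lane for this crux is at best a
negative lemma MODULO `H = (subexp iO ∧ (t,δ)-PPRF ∧ injective OWF exist)`, and modulo `H` a kill is
a universal white-box EXIT-finder. -/
theorem not_cruxShape_imp (obfGen : GenType) (h : ¬ CruxShape obfGen) :
    (∃ ε : ℝ, 0 < ε ∧ ε < 1 ∧ SubexpIOExist ε ∧
      ∃ P : PuncturablePRFScheme, IsTDSecurePuncturablePRF P (fun κ => (2 : ℝ) ^ ((κ : ℝ) ^ ε))
        (fun κ => (2 : ℝ) ^ (-((κ : ℝ) ^ ε)))) ∧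
    ∃ f : List Bool → List Bool, IsOneWay f ∧ Function.Injective f := by
  by_contra hcon
  apply h
  intro ε hε hε1 O hO P hP f hf hinj c _
  exfalso
  apply hcon
  exact ⟨⟨ε, hε, hε1, ⟨O, hO⟩, P, hP⟩, f, hf, hinj⟩

/-! ### §0b A typed trap: `ans` must be non-trivial on (almost) every seed of EVERY length

Clause (C) averages over ALL `s ∈ {0,1}ⁿ` for EVERY `n` and asks for decay along `n → ∞`. A
generator that parses `s = (k, coins)` only for lengths of a special form and sets `ans s = []`
(or any fixed string) on malformed seeds makes (C) FALSE: the coin-free constant algorithm wins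
whenever `ans s = []` (`[] <+: y` always). So the typed `obfuscatedGluedTreesGen` must stretch EVERY
seed of every length into keys and coins (PRG/KDF), never branch to a trivial answer. -/

/-- **Trap (refutes a sloppy typing, not the mechanism).** If for infinitely many lengths `n` every
seed of length `n` has the empty answer, clause (C) fails: the constant PPT algorithm outputting `[]`
succeeds with probability `1` at those lengths. -/
theorem clauseC_false_of_ans_nil_frequently (gen ans : List Bool → List Bool)
    (h : ∃ᶠ n in atTop, ∀ s : List Bool, s.length = n → ans s = []) : ¬ ClauseC gen ans := by
  classical
  intro hC
  set A : RandAlg (List Bool) (List Bool) := RandAlg.ofDet fun _ => ([] : List Bool) with hA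
  have hPPT : IsPPT A id :=
    RandAlg.IsPolyTime.ofDet_holds (PolyTimeComputable.const _ _ ([] : List Bool))
  have hdec := hC A hPPT
  set f : ℕ → ℝ := fun n => uniformAvg n fun s =>
    A.pr id (boolPair (Computability.unaryEncodeNat n) (gen s)) {y | ans s <+: y} with hf
  have hone : ∀ n, (∀ s : List Bool, s.length = n → ans s = []) → f n = 1 := by
    intro n hn
    have hpr : ∀ s : List Bool, s.length = n →
        A.pr id (boolPair (Computability.unaryEncodeNat n) (gen s)) {y | ans s <+: y} = 1 := by
      intro s hs
      rw [hA, RandAlg.pr_ofDet]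
      simp [hn s hs]
    simp only [hf, uniformAvg]
    rw [Finset.sum_congr rfl fun (x : List.Vector Bool n) _ => hpr x.toList (by simp)]
    simp [card_vector]
  have htend : Tendsto f atTop (nhds 0) := by
    have := hdec 0
    simpa [hf] using this
  have hev : ∀ᶠ n : ℕ in atTop, f n < 1 :=
    htend.eventually (gt_mem_nhds (by norm_num : (0 : ℝ) < 1))
  obtain ⟨n, hn, hlt⟩ := (h.and_eventually hev).exists
  rw [hone n hn] at hlt
  exact lt_irrefl _ hlt

/-! ## Graph facts used below (the tree's `GluedTrees` API) -/

namespace Graph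

open GluedTrees

variable {n : ℕ}

/-- A vertex of depth `0` on the left is the ENTRANCE. -/
theorem eq_entrance_of_depth_eq_zero {v : Vertex n} (hv : depth v = 0) (hb : v.1 = false) :
    v = entrance n := by
  have hidx : idx v = 0 := by
    have := idx_lt v
    rw [hv] at this
    omega
  exact Vertex.ext_iff'.mpr ⟨hb, hv, hidx⟩

/-- A vertex of depth `0` on the right is the EXIT. -/
theorem eq_exit_of_depth_eq_zero {v : Vertex n} (hv : depth v = 0) (hb : v.1 = true) :
    v = GluedTrees.exit n := by
  have hidx : idx v = 0 := by
    have := idx_lt v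
    rw [hv] at this
    omega
  exact Vertex.ext_iff'.mpr ⟨hb, hv, hidx⟩

/-- **EXIT is publicly verifiable**: for `1 ≤ n` the vertices of degree `2` are exactly the two
roots (everything else has degree `3`, `GluedTrees.degree_eq`). So a candidate answer is checked with
one evaluation of the neighbour circuit ("valid, two neighbours, not the ENTRANCE"), which is what
makes an attack on one iO transfer to all (re-obfuscate and compare success rates). -/
theorem degree_eq_two_iff (hn : 1 ≤ n) (σ : CycleDatum n) (v : Vertex n) :
    (graph n σ).degree v = 2 ↔ v = entrance n ∨ v = GluedTrees.exit n := by
  rw [degree_eq hn]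
  constructor
  · intro h
    have hv : depth v = 0 := by
      by_contra h0
      rw [if_neg h0] at h
      omega
    cases hb : v.1
    · exact Or.inl (eq_entrance_of_depth_eq_zero hv hb)
    · exact Or.inr (eq_exit_of_depth_eq_zero hv hb)
  · rintro (rfl | rfl) <;> simp

/-- Children are neighbours. -/
theorem adj_childV (σ : CycleDatum n) {v : Vertex n} (hv : depth v < n) (b : Bool) :
    (graph n σ).Adj v (childV v b) := by
  rw [← SimpleGraph.mem_neighborFinset, neighborFinset_of_depth_lt σ hv]
  cases b <;> simp

/-- The parent is a neighbour. -/
theorem adj_parentV (hn : 1 ≤ n) (σ : CycleDatum n) {v : Vertex n} (hv : 1 ≤ depth v) :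
    (graph n σ).Adj v (parentV v) := by
  by_cases hvn : depth v < n
  · rw [← SimpleGraph.mem_neighborFinset, neighborFinset_of_depth_lt σ hvn, if_neg (by omega)]
    simp
  · have hv' : depth v = n := le_antisymm (depth_le v) (not_lt.mp hvn)
    obtain ⟨i, rfl | rfl⟩ := exists_eq_leaf hv'
    · rw [← SimpleGraph.mem_neighborFinset, neighborFinset_leafL hn]; simp
    · rw [← SimpleGraph.mem_neighborFinset, neighborFinset_leafR hn]; simp

/-- The first cross (glued) neighbour of a leaf is a neighbour. -/
theorem adj_cross₁ (hn : 1 ≤ n) (σ : CycleDatum n) {v : Vertex n} (hv : depth v = n) :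
    (graph n σ).Adj v (cross₁ σ v) := by
  obtain ⟨i, rfl | rfl⟩ := exists_eq_leaf hv
  · rw [← SimpleGraph.mem_neighborFinset, neighborFinset_leafL hn, cross₁_leafL]; simp
  · rw [← SimpleGraph.mem_neighborFinset, neighborFinset_leafR hn, cross₁_leafR]; simp

/-- The only root adjacent to a child of EXIT is EXIT (`1 ≤ n`): the degree-2 test identifies the
canonical name of EXIT among the three names returned on a child of EXIT. -/
theorem eq_exit_of_adj_child_exit (hn : 1 ≤ n) (σ : CycleDatum n) (b : Bool) {w : Vertex n}
    (hw : (graph n σ).Adj (childV (GluedTrees.exit n) b) w) (hdeg : (graph n σ).degree w = 2) :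
    w = GluedTrees.exit n := by
  rcases (degree_eq_two_iff hn σ w).1 hdeg with rfl | rfl
  · exfalso
    have h0 : depth (entrance n) < n := by simp; omega
    have hw' := hw.symm
    rw [← SimpleGraph.mem_neighborFinset, neighborFinset_of_depth_lt σ h0, if_pos depth_entrance,
      Finset.empty_union, Finset.mem_insert, Finset.mem_singleton] at hw'
    have hside : (childV (GluedTrees.exit n) b).1 = true := by rw [childV_fst]; rfl
    rcases hw' with h | h <;> rw [h, childV_fst] at hside <;> simp at hside
  · rfl

end Graph

/-! ## §1 Load-bearing hypothesis: the canonical (sorted) order of the adjacency lists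

If the neighbour circuit lists the neighbours in ROLE order — `[parent] ++ [child₀, child₁]` at an
inner vertex, `[parent] ++ [glued₁, glued₂]` at a leaf — then evaluating it hands the adversary the
maps `parentV`, `childV · false`, `cross₁` at the level of names, and the following `2n+1`-step walk
outputs EXIT on every instance (probability 1, no cryptographic assumption touched). `descend` and
`ascend` are walks in `G'_n(σ)` (`Graph.adj_childV`, `Graph.adj_parentV`, `Graph.adj_cross₁`). The
tree's `gluedTreesOracle` sorts by binary value precisely to exclude this (its docstring says so);
the informal item text ("list of ≤ 3 neighbour names") does not fix the order — typing obligation. -/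

namespace RoleOrder

open GluedTrees

variable {n : ℕ}

/-- Go down `k` levels along first children. -/
def descend (v : Vertex n) : ℕ → Vertex n
  | 0 => v
  | k + 1 => childV (descend v k) false

/-- Go up `k` levels. -/
def ascend (v : Vertex n) : ℕ → Vertex n
  | 0 => v
  | k + 1 => parentV (ascend v k)

/-- The role walk: `n` steps down from the ENTRANCE, one glued edge, `n` steps up. -/
def roleWalk (σ : CycleDatum n) : Vertex n :=
  ascend (cross₁ σ (descend (entrance n) n)) n

/-- `k ≤ n` down-steps from the ENTRANCE stay on the left and reach depth `k`. -/
theorem descend_spec (k : ℕ) (hk : k ≤ n) :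
    (descend (entrance n) k).1 = false ∧ depth (descend (entrance n) k) = k := by
  induction k with
  | zero => exact ⟨rfl, rfl⟩
  | succ k ih =>
    obtain ⟨h1, h2⟩ := ih (by omega)
    have hlt : depth (descend (entrance n) k) < n := by omega
    refine ⟨?_, ?_⟩
    · show (childV (descend (entrance n) k) false).1 = false
      rw [childV_fst, h1]
    · show depth (childV (descend (entrance n) k) false) = k + 1
      rw [depth_childV hlt, h2]

/-- `k` up-steps keep the side and decrease the depth by `k`. -/
theorem ascend_spec (v : Vertex n) (k : ℕ) :
    (ascend v k).1 = v.1 ∧ depth (ascend v k) = depth v - k := by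
  induction k with
  | zero => exact ⟨rfl, rfl⟩
  | succ k ih =>
    obtain ⟨h1, h2⟩ := ih
    refine ⟨?_, ?_⟩
    · show (parentV (ascend v k)).1 = v.1
      rw [parentV_fst, h1]
    · show depth (parentV (ascend v k)) = depth v - (k + 1)
      rw [depth_parentV, h2]
      omega

/-- **The role-ordered mutant is broken**: the role walk ends at the EXIT, for every `n` and every
cycle datum `σ` (for `n = 0` as well, where `cross₁` of the ENTRANCE-leaf is the EXIT-leaf). -/
theorem roleWalk_eq_exit (σ : CycleDatum n) : roleWalk σ = GluedTrees.exit n := by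
  obtain ⟨hs, hd⟩ := descend_spec (n := n) n le_rfl
  have hc1 : (cross₁ σ (descend (entrance n) n)).1 = true := by
    rw [cross₁_fst hd, hs]; rfl
  have hc2 : depth (cross₁ σ (descend (entrance n) n)) = n := depth_cross₁ hd
  obtain ⟨ha1, ha2⟩ := ascend_spec (cross₁ σ (descend (entrance n) n)) n
  have h0 : depth (roleWalk σ) = 0 := by
    show depth (ascend (cross₁ σ (descend (entrance n) n)) n) = 0
    rw [ha2, hc2]; simp
  have h1 : (roleWalk σ).1 = true := by
    show (ascend (cross₁ σ (descend (entrance n) n)) n).1 = true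
    rw [ha1, hc1]
  exact Graph.eq_exit_of_depth_eq_zero h0 h1

/-- Each step of the role walk is an edge of `G'_n(σ)` (`1 ≤ n`): down-steps. -/
theorem adj_descend_succ (σ : CycleDatum n) (k : ℕ) (hk : k < n) :
    (graph n σ).Adj (descend (entrance n) k) (descend (entrance n) (k + 1)) := by
  have := (descend_spec (n := n) k hk.le).2
  exact Graph.adj_childV σ (by omega) false

/-- Each step of the role walk is an edge of `G'_n(σ)` (`1 ≤ n`): the glued step. -/
theorem adj_glued_step (hn : 1 ≤ n) (σ : CycleDatum n) :
    (graph n σ).Adj (descend (entrance n) n) (cross₁ σ (descend (entrance n) n)) :=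
  Graph.adj_cross₁ hn σ (descend_spec (n := n) n le_rfl).2

/-- Each step of the role walk is an edge of `G'_n(σ)` (`1 ≤ n`): up-steps. -/
theorem adj_ascend_succ (hn : 1 ≤ n) (σ : CycleDatum n) (k : ℕ) (hk : k < n) :
    (graph n σ).Adj (ascend (cross₁ σ (descend (entrance n) n)) k)
      (ascend (cross₁ σ (descend (entrance n) n)) (k + 1)) := by
  have hd := (descend_spec (n := n) n le_rfl).2
  have hc2 : depth (cross₁ σ (descend (entrance n) n)) = n := depth_cross₁ hd
  have := (ascend_spec (cross₁ σ (descend (entrance n) n)) k).2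
  exact Graph.adj_parentV hn σ (by omega)

end RoleOrder

/-! ### §1b Load-bearing hypothesis: names must hide the DEPTH (any root-ward monotone quantity)

Cousin of §1. If anything efficiently computable from a name (its format, its length, a level tag,
a level-indexed key that can be told apart, an `r`-collision with a vertex of known label, …) reveals
the depth of the vertex — or merely decides which of two adjacent vertices is shallower — then the
adversary climbs: at a non-root vertex the parent is the UNIQUE strictly shallower neighbour
(`eq_parentV_of_adj_of_depth_lt`), so "go down `n` times, cross once, then repeatedly move to the
shallower neighbour" is the role walk of §1 and ends at EXIT (`RoleOrder.roleWalk_eq_exit`) after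
`2n+1` moves and `≤ 3(2n+1)` evaluations. Relevant to the planner's suggested repair "level-indexed
PRFs so a whole level dies by one puncture": the level index must stay invisible in the name. -/

namespace DepthLeak

open GluedTrees

variable {n : ℕ}

/-- **The parent is the unique strictly shallower neighbour** of any vertex of `G'_n(σ)` (`1 ≤ n`):
children are deeper, cross neighbours of a leaf are leaves of the same depth. -/
theorem eq_parentV_of_adj_of_depth_lt (hn : 1 ≤ n) (σ : CycleDatum n) {v w : Vertex n}
    (hadj : (graph n σ).Adj v w) (hlt : depth w < depth v) : w = parentV v := by
  by_cases hv : depth v < n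
  · rw [← SimpleGraph.mem_neighborFinset, neighborFinset_of_depth_lt σ hv] at hadj
    simp only [Finset.mem_union, Finset.mem_insert, Finset.mem_singleton] at hadj
    rcases hadj with h | h | h
    · split_ifs at h with h0
      · simp at h
      · simpa using h
    · exfalso
      have := congrArg depth h
      rw [depth_childV hv] at this
      omega
    · exfalso
      have := congrArg depth h
      rw [depth_childV hv] at this
      omega
  · have hv' : depth v = n := le_antisymm (depth_le v) (not_lt.mp hv)
    obtain ⟨i, rfl | rfl⟩ := exists_eq_leaf hv'
    · rw [← SimpleGraph.mem_neighborFinset, neighborFinset_leafL hn] at hadj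
      simp only [Finset.mem_insert, Finset.mem_singleton] at hadj
      rcases hadj with h | h | h
      · exact h
      · exfalso; rw [h] at hlt; simp at hlt
      · exfalso; rw [h] at hlt; simp at hlt
    · rw [← SimpleGraph.mem_neighborFinset, neighborFinset_leafR hn] at hadj
      simp only [Finset.mem_insert, Finset.mem_singleton] at hadj
      rcases hadj with h | h | h
      · exact h
      · exfalso; rw [h] at hlt; simp at hlt
      · exfalso; rw [h] at hlt; simp at hlt

/-- Conversely the parent IS strictly shallower (non-root vertex), so a depth-comparison oracle on
names singles it out among the `≤ 3` neighbours. -/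
theorem depth_parentV_lt {v : Vertex n} (hv : 1 ≤ depth v) : depth (parentV v) < depth v := by
  rw [depth_parentV]; omega

/-- **The depth-leaking mutant is broken**: with the shallower-neighbour rule available, the climb
from the crossed leaf is `RoleOrder.ascend` and the whole walk ends at EXIT. -/
theorem depthWalk_eq_exit (σ : CycleDatum n) : RoleOrder.roleWalk σ = GluedTrees.exit n :=
  RoleOrder.roleWalk_eq_exit σ

end DepthLeak

/-! ## §1c Load-bearing hypothesis: NO complete layer of the trees may be recognisable (altimeter)

Generalises §1b (which needed a depth COMPARISON between adjacent names). Suppose some efficiently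
decidable predicate `R` on names recognises ONE layer `m` below the current vertex in the weak sense
`{depth = m, same side} ⊆ R ⊆ {depth ≥ m - 1}` (a visible level tag of level `m`; a level-`m` key
that can be told apart; for a structured cycle, the glue 4-cycles of §1d with `m = n - 1`; for a
key-holding REDUCTION, any layer whose naming key it owns — ideator 2's B2). Then at a vertex `x`
of depth `1 ≤ j < m` entered from a KNOWN child, the two other neighbours `y` (the parent and the
other child) are told apart by ONE arbitrary non-backtracking walk of `m - j - 1` further steps from
`y` avoiding `x`: from the child every such walk is FORCED downwards (the only way up is back) and
ends at depth exactly `m` (`forced_descent`, `child_walk_end`), from the parent depth is 1-Lipschitz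
so the walk ends at depth `≤ m - 2` (`depth_walk_le`, `parent_walk_end`); `altimeter` is the
resulting dichotomy `end ∈ R ↔ y is the child`. Iterating from a right leaf (where the adversary
arrives by `n` remembered down-steps and one glued edge) identifies the parent at every level at a
cost of `≤ 2(m - j) + O(1)` evaluations, i.e. EXIT in `O(n²)` evaluations with probability `1`.
So the typed naming/obfuscation must hide EVERY complete layer, not only the depth order. -/

namespace Altimeter

open GluedTrees

variable {n : ℕ}

/-- Depth is 1-Lipschitz along the edges of `G'_n(σ)` (tree edges change it by one, glued edges
join two leaves). -/
theorem depth_le_of_adj (σ : CycleDatum n) {u v : Vertex n} (h : (graph n σ).Adj u v) :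
    depth v ≤ depth u + 1 ∧ depth u ≤ depth v + 1 := by
  rw [graph_adj] at h
  obtain ⟨-, (hc | hg) | (hc | hg)⟩ := h
  · obtain ⟨-, hd, -⟩ := isChild_iff.mp hc
    exact ⟨by omega, by omega⟩
  · obtain ⟨h1, h2⟩ := depth_eq_of_isGlued hg
    exact ⟨by omega, by omega⟩
  · obtain ⟨-, hd, -⟩ := isChild_iff.mp hc
    exact ⟨by omega, by omega⟩
  · obtain ⟨h1, h2⟩ := depth_eq_of_isGlued hg
    exact ⟨by omega, by omega⟩

/-- An edge with a non-leaf endpoint is a tree edge: it keeps the side. -/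
theorem fst_eq_of_adj (σ : CycleDatum n) {u v : Vertex n} (h : (graph n σ).Adj u v)
    (hu : depth u < n) : u.1 = v.1 := by
  rw [graph_adj] at h
  obtain ⟨-, (hc | hg) | (hc | hg)⟩ := h
  · exact (isChild_iff.mp hc).1
  · have := (depth_eq_of_isGlued hg).1; omega
  · exact (isChild_iff.mp hc).1.symm
  · have := (depth_eq_of_isGlued hg).2; omega

/-- **Lemma B (any walk)**: after `k` steps along edges the depth has grown by at most `k`. -/
theorem depth_walk_le (σ : CycleDatum n) (w : ℕ → Vertex n) (i₀ : ℕ) :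
    ∀ k, (∀ i, i₀ ≤ i → i < i₀ + k → (graph n σ).Adj (w i) (w (i + 1))) →
      depth (w (i₀ + k)) ≤ depth (w i₀) + k := by
  intro k
  induction k with
  | zero => intro _; simp
  | succ k ih =>
    intro hadj
    have h1 : depth (w (i₀ + k)) ≤ depth (w i₀) + k :=
      ih fun i hi hik => hadj i hi (by omega)
    have h2 := (depth_le_of_adj σ (hadj (i₀ + k) (by omega) (by omega))).1
    rw [show i₀ + (k + 1) = i₀ + k + 1 by omega]
    omega

/-- A neighbour of an inner vertex other than its parent is one of its two children. -/
theorem eq_childV_of_adj_of_ne_parentV (σ : CycleDatum n) {v u : Vertex n} (hv : depth v < n)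
    (hadj : (graph n σ).Adj v u) (hne : u ≠ parentV v) : ∃ b, u = childV v b := by
  rw [← SimpleGraph.mem_neighborFinset, neighborFinset_of_depth_lt σ hv] at hadj
  simp only [Finset.mem_union, Finset.mem_insert, Finset.mem_singleton] at hadj
  rcases hadj with h | h | h
  · split_ifs at h with h0
    · simp at h
    · simp only [Finset.mem_singleton] at h
      exact absurd h hne
  · exact ⟨false, h⟩
  · exact ⟨true, h⟩

/-- **Lemma A (forced descent)**: a non-backtracking walk `x = w 0, w 1 = child of x, w 2, …` whose
steps are edges goes DOWN at every step while it is above the leaves: `w i` has depth `depth x + i`,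
its predecessor is its parent, and it stays on the side of `x`. -/
theorem forced_descent (σ : CycleDatum n) {K : ℕ} (w : ℕ → Vertex n) {x : Vertex n} {b : Bool}
    (hx : depth x < n) (h0 : w 0 = x) (h1 : w 1 = childV x b)
    (hadj : ∀ i, i < K → (graph n σ).Adj (w i) (w (i + 1)))
    (hnb : ∀ i, i + 2 ≤ K → w (i + 2) ≠ w i) :
    ∀ i, 1 ≤ i → i ≤ K → depth x + i ≤ n →
      depth (w i) = depth x + i ∧ parentV (w i) = w (i - 1) ∧ (w i).1 = x.1 := by
  intro i
  induction i with
  | zero => intro h; omega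
  | succ i ih =>
    intro _ hiK hin
    rcases Nat.eq_zero_or_pos i with rfl | hipos
    · refine ⟨?_, ?_, ?_⟩
      · rw [zero_add, h1, depth_childV hx]
      · rw [zero_add, h1, parentV_childV hx, Nat.sub_self, h0]
      · rw [zero_add, h1, childV_fst]
    · obtain ⟨hd, hp, hs⟩ := ih hipos (by omega) (by omega)
      have hlt : depth (w i) < n := by omega
      have hne : w (i + 1) ≠ parentV (w i) := by
        rw [hp]
        have := hnb (i - 1) (by omega)
        rwa [show i - 1 + 2 = i + 1 by omega] at this
      obtain ⟨b', hb'⟩ := eq_childV_of_adj_of_ne_parentV σ hlt (hadj i (by omega)) hne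
      refine ⟨?_, ?_, ?_⟩
      · rw [hb', depth_childV hlt, hd, Nat.add_assoc]
      · rw [hb', parentV_childV hlt, Nat.add_sub_cancel]
      · rw [hb', childV_fst, hs]

/-- **From the other child the walk ends ON layer `m`** (same side as `x`): `K = m - depth x`
edges from `x` through the child. -/
theorem child_walk_end (σ : CycleDatum n) {m : ℕ} (hm : m ≤ n) (w : ℕ → Vertex n) {x : Vertex n}
    {b : Bool} (hxm : depth x < m) (h0 : w 0 = x) (h1 : w 1 = childV x b)
    (hadj : ∀ i, i < m - depth x → (graph n σ).Adj (w i) (w (i + 1)))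
    (hnb : ∀ i, i + 2 ≤ m - depth x → w (i + 2) ≠ w i) :
    depth (w (m - depth x)) = m ∧ (w (m - depth x)).1 = x.1 := by
  obtain ⟨hd, -, hs⟩ := forced_descent σ w (by omega) h0 h1 hadj hnb (m - depth x)
    (by omega) le_rfl (by omega)
  exact ⟨by omega, hs⟩

/-- **From the parent the walk ends at depth `≤ m - 2`**, whatever it does. -/
theorem parent_walk_end (σ : CycleDatum n) {m : ℕ} (w : ℕ → Vertex n) {x : Vertex n}
    (hx : 1 ≤ depth x) (hxm : depth x < m) (h1 : w 1 = parentV x)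
    (hadj : ∀ i, i < m - depth x → (graph n σ).Adj (w i) (w (i + 1))) :
    depth (w (m - depth x)) + 2 ≤ m := by
  have h := depth_walk_le σ w 1 (m - depth x - 1) fun i hi hik => hadj i (by omega)
  rw [show 1 + (m - depth x - 1) = m - depth x by omega, h1, depth_parentV] at h
  omega

/-- **The altimeter.** `R` recognises layer `m` weakly (`{depth = m on the side of x} ⊆ R ⊆
{depth ≥ m - 1}`); `x` has depth `1 ≤ j < m ≤ n`; `w` is any walk `x = w 0, w 1 = y, …, w (m - j)`
along edges, non-backtracking (in particular `w 2 ≠ x`). If `y` is a child the end vertex is in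
`R`; if `y` is the parent it is not. One walk per candidate identifies the parent. -/
theorem altimeter (σ : CycleDatum n) {m : ℕ} (hm : m ≤ n) (R : Set (Vertex n)) {x : Vertex n}
    (hR₁ : ∀ v, depth v = m → v.1 = x.1 → v ∈ R) (hR₂ : ∀ v ∈ R, m ≤ depth v + 1)
    (hx : 1 ≤ depth x) (hxm : depth x < m) (w : ℕ → Vertex n) (h0 : w 0 = x)
    (hadj : ∀ i, i < m - depth x → (graph n σ).Adj (w i) (w (i + 1)))
    (hnb : ∀ i, i + 2 ≤ m - depth x → w (i + 2) ≠ w i) :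
    ((∃ b, w 1 = childV x b) → w (m - depth x) ∈ R) ∧
      (w 1 = parentV x → w (m - depth x) ∉ R) := by
  constructor
  · rintro ⟨b, h1⟩
    obtain ⟨hd, hs⟩ := child_walk_end σ hm w hxm h0 h1 hadj hnb
    exact hR₁ _ hd hs
  · intro h1 hmem
    have h := parent_walk_end σ w hx hxm h1 hadj
    have h' := hR₂ _ hmem
    omega

/-- The neighbours of an inner vertex ARE its parent (absent at a root) and its two children, so
the altimeter's dichotomy is exhaustive. -/
theorem adj_cases (σ : CycleDatum n) {x y : Vertex n} (hx : depth x < n)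
    (h : (graph n σ).Adj x y) : (depth x ≠ 0 ∧ y = parentV x) ∨ ∃ b, y = childV x b := by
  rw [← SimpleGraph.mem_neighborFinset, neighborFinset_of_depth_lt σ hx] at h
  simp only [Finset.mem_union, Finset.mem_insert, Finset.mem_singleton] at h
  rcases h with h | h | h
  · split_ifs at h with h0
    · simp at h
    · simp only [Finset.mem_singleton] at h
      exact Or.inl ⟨h0, h⟩
  · exact Or.inr ⟨false, h⟩
  · exact Or.inr ⟨true, h⟩

end Altimeter

/-! ## §1d Load-bearing hypothesis: the alternating cycle must be (pseudo)RANDOM — the structured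
cycle `σ₀` is broken classically in `O(n²)` evaluations

Cycle 1 (§4) left "public cycle `σ`" open. Sharpening: what matters is not publicity but
STRUCTURE. For the structured datum `σ₀ = (id, id)` (left leaf `k` — right leaf `k` — left leaf
`k+1` — …; a legitimate `G'_n`, on which the quantum walk behaves exactly as on any other cycle,
the column reduction being `σ`-independent) the glue edges create 4-cycles through every vertex
of the bottom two layers and through no other vertex: `OnSquare v ↔ n - 1 ≤ depth v`
(`onSquare_σ₀_iff`; the direction "no squares above the bottom two layers" holds for EVERY `σ`,
`not_onSquare_of_depth_add_two_le`). `OnSquare` is decided with `4` evaluations of the neighbour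
map on canonical names, so it is a recogniser `R` for layer `m = n - 1` in the sense of §1c
(`σ₀_altimeter`), it orients the adversary at the right leaf where it enters
(`σ₀_leaf_orientation`: the parent is the unique neighbour with a neighbour outside `R`) and one
level up (`σ₀_orientation_pred`: the parent is the unique neighbour outside `R`). Total: descend
`n`, cross `1`, orient `O(1)`, then `≤ 2(n - 1 - j) + 8` evaluations per level `j = n-2, …, 1` —
EXIT with probability `1` in `≤ n² + 10n + 30` evaluations on EVERY instance with cycle `σ₀`, with
or without obfuscation. Hence the PRP key of the cycle is exactly as sensitive as the naming keys,
every hybrid of a would-be proof must keep the cycle free of short glue cycles near the leaves, and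
ChildsEtAl2003 Thm 9 visibly needs its random cycle (their Lemma: the random `G'_n` has no short
cycles through the glue seen by a subexponential explorer). -/

namespace StructuredCycle

open GluedTrees

variable {n : ℕ}

/-- `v` lies on a 4-cycle `v — z₁ — w — z₂ — v` of `G`. Decidable at name level with `4`
evaluations of the neighbour map (names are canonical). -/
def OnSquare {V : Type*} (G : SimpleGraph V) (v : V) : Prop :=
  ∃ z₁ z₂ w : V, G.Adj v z₁ ∧ G.Adj v z₂ ∧ z₁ ≠ z₂ ∧ w ≠ v ∧ G.Adj z₁ w ∧ G.Adj z₂ w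

/-- **No squares above the bottom two layers, for EVERY cycle datum**: a vertex of depth
`≤ n - 2` lies on no 4-cycle (its radius-2 ball is a tree). -/
theorem not_onSquare_of_depth_add_two_le (σ : CycleDatum n) {v : Vertex n} (hv : depth v + 2 ≤ n) :
    ¬ OnSquare (graph n σ) v := by
  rintro ⟨z₁, z₂, w, h1, h2, hne, hwv, hw1, hw2⟩
  have hvn : depth v < n := by omega
  -- through a child `z` of `v`, the far vertex `w ≠ v` is a grandchild: `parentV w = z`
  have hchild : ∀ (z : Vertex n) (b : Bool), z = childV v b → (graph n σ).Adj z w → parentV w = z := by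
    intro z b hz hzw
    have hz' : depth z < n := by rw [hz, depth_childV hvn]; omega
    have hwne : w ≠ parentV z := by rw [hz, parentV_childV hvn]; exact hwv
    obtain ⟨b', hb'⟩ := Altimeter.eq_childV_of_adj_of_ne_parentV σ hz' hzw hwne
    rw [hb', parentV_childV hz']
  have hchild_depth : ∀ (z : Vertex n) (b : Bool), z = childV v b → (graph n σ).Adj z w →
      depth w = depth v + 2 := by
    intro z b hz hzw
    have hp := hchild z b hz hzw
    have hz' : depth z = depth v + 1 := by rw [hz, depth_childV hvn]
    have := congrArg depth hp
    rw [depth_parentV, hz'] at this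
    have hw1 := (Altimeter.depth_le_of_adj σ hzw).1
    omega
  -- through the parent, `w` has depth `≤ depth v`
  have hpar : ∀ z : Vertex n, depth v ≠ 0 → z = parentV v → (graph n σ).Adj z w →
      depth w ≤ depth v := by
    intro z h0 hz hzw
    have := (Altimeter.depth_le_of_adj σ hzw).1
    rw [hz, depth_parentV] at this
    omega
  rcases Altimeter.adj_cases σ hvn h1 with ⟨h01, hz1⟩ | ⟨b₁, hz1⟩ <;>
    rcases Altimeter.adj_cases σ hvn h2 with ⟨h02, hz2⟩ | ⟨b₂, hz2⟩
  · exact hne (hz1.trans hz2.symm)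
  · have := hpar z₁ h01 hz1 hw1
    have := hchild_depth z₂ b₂ hz2 hw2
    omega
  · have := hpar z₂ h02 hz2 hw2
    have := hchild_depth z₁ b₁ hz1 hw1
    omega
  · have e1 := hchild z₁ b₁ hz1 hw1
    have e2 := hchild z₂ b₂ hz2 hw2
    exact hne (e1.symm.trans e2)

/-- The structured cycle datum `σ₀ = (id, id)`: edges `leafL k — leafR k` and `leafR k — leafL (k+1)`. -/
def σ₀ (n : ℕ) : CycleDatum n := (Equiv.refl _, Equiv.refl _)

theorem crossL_σ₀_fst (k : Fin (2 ^ n)) : (crossL (σ₀ n) k).1 = k := rfl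
theorem crossL_σ₀_snd (k : Fin (2 ^ n)) : (crossL (σ₀ n) k).2 = finRotate _ k := rfl
theorem crossR_σ₀_fst (k : Fin (2 ^ n)) : (crossR (σ₀ n) k).1 = k := rfl
theorem crossR_σ₀_snd (k : Fin (2 ^ n)) : (crossR (σ₀ n) k).2 = (finRotate _).symm k := rfl

/-- `finRotate` on a non-last element, anonymous-constructor form. -/
theorem finRotate_mk {M k : ℕ} (h : k + 1 < M) :
    finRotate M ⟨k, (Nat.lt_succ_self k).trans h⟩ = ⟨k + 1, h⟩ := by
  obtain ⟨N, rfl⟩ : ∃ N, M = N + 1 := ⟨M - 1, by omega⟩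
  exact finRotate_of_lt (Nat.lt_of_succ_lt_succ h)

/-- Inverse rotation, anonymous-constructor form. -/
theorem finRotate_symm_mk {M k : ℕ} (h : k + 1 < M) :
    (finRotate M).symm ⟨k + 1, h⟩ = ⟨k, (Nat.lt_succ_self k).trans h⟩ := by
  rw [Equiv.symm_apply_eq]
  exact (finRotate_mk h).symm

/-- `2 ^ n` is even for `1 ≤ n` (so an even position `2 i < 2 ^ n` has `2 i + 1 < 2 ^ n`). -/
theorem two_pow_even (hn : 1 ≤ n) : ∃ M, 2 ^ n = 2 * M := by
  obtain ⟨m, rfl⟩ : ∃ m, n = m + 1 := ⟨n - 1, by omega⟩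
  exact ⟨2 ^ m, by rw [pow_succ, mul_comm]⟩

/-- A child of a vertex of depth `n - 1` on the right is the right leaf `2 i + b`. -/
theorem childV_eq_leafR {v : Vertex n} (hv : depth v + 1 = n) (hs : v.1 = true) (b : Bool) :
    childV v b = leafR n ⟨2 * idx v + b.toNat,
      (two_mul_idx_add_lt v b).trans_eq (by rw [hv])⟩ := by
  rw [Vertex.ext_iff']
  refine ⟨?_, ?_, ?_⟩
  · rw [childV_fst, hs]; rfl
  · rw [depth_childV (by omega), depth_leafR, hv]
  · rw [idx_childV (by omega), idx_leafR]

/-- A child of a vertex of depth `n - 1` on the left is the left leaf `2 i + b`. -/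
theorem childV_eq_leafL {v : Vertex n} (hv : depth v + 1 = n) (hs : v.1 = false) (b : Bool) :
    childV v b = leafL n ⟨2 * idx v + b.toNat,
      (two_mul_idx_add_lt v b).trans_eq (by rw [hv])⟩ := by
  rw [Vertex.ext_iff']
  refine ⟨?_, ?_, ?_⟩
  · rw [childV_fst, hs]; rfl
  · rw [depth_childV (by omega), depth_leafL, hv]
  · rw [idx_childV (by omega), idx_leafL]

/-- Adjacency read off the leaf neighbourhoods (right leaf, first cross neighbour). -/
theorem adj_leafR_crossL_fst (hn : 1 ≤ n) (σ : CycleDatum n) (i : Fin (2 ^ n)) :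
    (graph n σ).Adj (leafR n i) (leafL n (crossL σ i).1) := by
  rw [← SimpleGraph.mem_neighborFinset, neighborFinset_leafR hn]; simp

/-- Adjacency read off the leaf neighbourhoods (right leaf, second cross neighbour). -/
theorem adj_leafR_crossL_snd (hn : 1 ≤ n) (σ : CycleDatum n) (i : Fin (2 ^ n)) :
    (graph n σ).Adj (leafR n i) (leafL n (crossL σ i).2) := by
  rw [← SimpleGraph.mem_neighborFinset, neighborFinset_leafR hn]; simp

/-- Adjacency read off the leaf neighbourhoods (left leaf, first cross neighbour). -/
theorem adj_leafL_crossR_fst (hn : 1 ≤ n) (σ : CycleDatum n) (i : Fin (2 ^ n)) :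
    (graph n σ).Adj (leafL n i) (leafR n (crossR σ i).1) := by
  rw [← SimpleGraph.mem_neighborFinset, neighborFinset_leafL hn]; simp

/-- Adjacency read off the leaf neighbourhoods (left leaf, second cross neighbour). -/
theorem adj_leafL_crossR_snd (hn : 1 ≤ n) (σ : CycleDatum n) (i : Fin (2 ^ n)) :
    (graph n σ).Adj (leafL n i) (leafR n (crossR σ i).2) := by
  rw [← SimpleGraph.mem_neighborFinset, neighborFinset_leafL hn]; simp

/-- **(a) Layer `n - 1` lies on glue squares under `σ₀`** (both sides): the two leaf children
`2i`, `2i+1` of `v` have a common cross neighbour (`leafL (2i+1)` on the right, `leafR (2i)` on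
the left). -/
theorem onSquare_σ₀_of_depth_succ_eq (hn : 1 ≤ n) {v : Vertex n} (hv : depth v + 1 = n) :
    OnSquare (graph n (σ₀ n)) v := by
  have hvn : depth v < n := by omega
  have hlt1 : 2 * idx v + 1 < 2 ^ n := (two_mul_idx_add_lt v true).trans_eq (by rw [hv])
  have hlt0 : 2 * idx v < 2 ^ n := by omega
  cases hs : v.1
  · -- left: children leafL 2i, leafL (2i+1); common right neighbour leafR 2i
    refine ⟨childV v false, childV v true, leafR n ⟨2 * idx v, hlt0⟩, Graph.adj_childV _ hvn _,
      Graph.adj_childV _ hvn _, childV_false_ne_true hvn, ?_, ?_, ?_⟩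
    · intro h; have := congrArg Prod.fst h; rw [hs] at this; simp at this
    · rw [childV_eq_leafL hv hs false]
      have := adj_leafL_crossR_fst hn (σ₀ n) ⟨2 * idx v + false.toNat, by simpa using hlt0⟩
      rw [crossR_σ₀_fst] at this
      simpa using this
    · rw [childV_eq_leafL hv hs true]
      have := adj_leafL_crossR_snd hn (σ₀ n) ⟨2 * idx v + true.toNat, by simpa using hlt1⟩
      rw [crossR_σ₀_snd] at this
      simp only [Bool.toNat_true] at this
      rwa [finRotate_symm_mk hlt1] at this
  · -- right: children leafR 2i, leafR (2i+1); common left neighbour leafL (2i+1)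
    refine ⟨childV v false, childV v true, leafL n ⟨2 * idx v + 1, hlt1⟩, Graph.adj_childV _ hvn _,
      Graph.adj_childV _ hvn _, childV_false_ne_true hvn, ?_, ?_, ?_⟩
    · intro h; have := congrArg Prod.fst h; rw [hs] at this; simp at this
    · rw [childV_eq_leafR hv hs false]
      have := adj_leafR_crossL_snd hn (σ₀ n) ⟨2 * idx v + false.toNat, by simpa using hlt0⟩
      rw [crossL_σ₀_snd] at this
      simp only [Bool.toNat_false, add_zero] at this
      rwa [finRotate_mk hlt1] at this
    · rw [childV_eq_leafR hv hs true]
      have := adj_leafR_crossL_fst hn (σ₀ n) ⟨2 * idx v + true.toNat, by simpa using hlt1⟩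
      rw [crossL_σ₀_fst] at this
      simpa using this

/-- Sibling leaves have the same parent (right). -/
theorem parentV_leafR_eq {i j : Fin (2 ^ n)} (h : (i : ℕ) / 2 = (j : ℕ) / 2) :
    parentV (leafR n i) = parentV (leafR n j) := by
  rw [Vertex.ext_iff']
  exact ⟨rfl, rfl, by rw [idx_parentV, idx_parentV, idx_leafR, idx_leafR, h]⟩

/-- Sibling leaves have the same parent (left). -/
theorem parentV_leafL_eq {i j : Fin (2 ^ n)} (h : (i : ℕ) / 2 = (j : ℕ) / 2) :
    parentV (leafL n i) = parentV (leafL n j) := by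
  rw [Vertex.ext_iff']
  exact ⟨rfl, rfl, by rw [idx_parentV, idx_parentV, idx_leafL, idx_leafL, h]⟩

/-- **(c) The leaves lie on glue squares under `σ₀`** (right leaves). Even `k = 2i`: the cross
neighbours `leafL 2i`, `leafL (2i+1)` are siblings; odd `k = 2i+1`: the parent and the cross
neighbour `leafL (2i+1)` are both adjacent to the sibling `leafR 2i`. -/
theorem onSquare_σ₀_leafR (hn : 1 ≤ n) (k : Fin (2 ^ n)) : OnSquare (graph n (σ₀ n)) (leafR n k) := by
  obtain ⟨M, hM⟩ := two_pow_even hn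
  obtain ⟨k, hklt⟩ := k
  obtain ⟨i, hk | hk⟩ : ∃ i, k = 2 * i ∨ k = 2 * i + 1 := ⟨k / 2, by omega⟩ <;> subst hk
  · -- even
    have hlt1 : 2 * i + 1 < 2 ^ n := by omega
    refine ⟨leafL n ⟨2 * i, hklt⟩, leafL n ⟨2 * i + 1, hlt1⟩, parentV (leafL n ⟨2 * i, hklt⟩),
      ?_, ?_, ?_, ?_, ?_, ?_⟩
    · exact adj_leafR_crossL_fst hn (σ₀ n) ⟨2 * i, hklt⟩
    · have := adj_leafR_crossL_snd hn (σ₀ n) ⟨2 * i, hklt⟩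
      rw [crossL_σ₀_snd] at this
      rwa [finRotate_mk hlt1] at this
    · intro h; have := congrArg idx h; simp at this
    · intro h; have := congrArg Prod.fst h; simp at this
    · exact Graph.adj_parentV hn _ (by simp; omega)
    · rw [parentV_leafL_eq (i := ⟨2 * i, hklt⟩) (j := ⟨2 * i + 1, hlt1⟩)
        (by show 2 * i / 2 = (2 * i + 1) / 2; omega)]
      exact Graph.adj_parentV hn _ (by simp; omega)
  · -- odd
    have hlt0 : 2 * i < 2 ^ n := by omega
    refine ⟨parentV (leafR n ⟨2 * i + 1, hklt⟩), leafL n ⟨2 * i + 1, hklt⟩, leafR n ⟨2 * i, hlt0⟩,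
      Graph.adj_parentV hn _ (by simp; omega), ?_, ?_, ?_, ?_, ?_⟩
    · exact adj_leafR_crossL_fst hn (σ₀ n) ⟨2 * i + 1, hklt⟩
    · intro h; have := congrArg Prod.fst h; simp at this
    · intro h; have := congrArg idx h; simp at this
    · rw [parentV_leafR_eq (i := ⟨2 * i + 1, hklt⟩) (j := ⟨2 * i, hlt0⟩)
        (by show (2 * i + 1) / 2 = 2 * i / 2; omega)]
      exact (Graph.adj_parentV hn _ (by simp; omega)).symm
    · have := adj_leafL_crossR_snd hn (σ₀ n) ⟨2 * i + 1, hklt⟩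
      rwa [crossR_σ₀_snd, finRotate_symm_mk hklt] at this

/-- **(c) The leaves lie on glue squares under `σ₀`** (left leaves). Odd `k = 2i+1`: the cross
neighbours `leafR (2i+1)`, `leafR 2i` are siblings; even `k = 2i`: the parent and the cross
neighbour `leafR 2i` are both adjacent to the sibling `leafL (2i+1)`. -/
theorem onSquare_σ₀_leafL (hn : 1 ≤ n) (k : Fin (2 ^ n)) : OnSquare (graph n (σ₀ n)) (leafL n k) := by
  obtain ⟨M, hM⟩ := two_pow_even hn
  obtain ⟨k, hklt⟩ := k
  obtain ⟨i, hk | hk⟩ : ∃ i, k = 2 * i ∨ k = 2 * i + 1 := ⟨k / 2, by omega⟩ <;> subst hk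
  · -- even
    have hlt1 : 2 * i + 1 < 2 ^ n := by omega
    refine ⟨parentV (leafL n ⟨2 * i, hklt⟩), leafR n ⟨2 * i, hklt⟩, leafL n ⟨2 * i + 1, hlt1⟩,
      Graph.adj_parentV hn _ (by simp; omega), ?_, ?_, ?_, ?_, ?_⟩
    · exact adj_leafL_crossR_fst hn (σ₀ n) ⟨2 * i, hklt⟩
    · intro h; have := congrArg Prod.fst h; simp at this
    · intro h; have := congrArg idx h; simp at this
    · rw [parentV_leafL_eq (i := ⟨2 * i, hklt⟩) (j := ⟨2 * i + 1, hlt1⟩)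
        (by show 2 * i / 2 = (2 * i + 1) / 2; omega)]
      exact (Graph.adj_parentV hn _ (by simp; omega)).symm
    · have := adj_leafR_crossL_snd hn (σ₀ n) ⟨2 * i, hklt⟩
      rwa [crossL_σ₀_snd, finRotate_mk hlt1] at this
  · -- odd
    have hlt0 : 2 * i < 2 ^ n := by omega
    refine ⟨leafR n ⟨2 * i + 1, hklt⟩, leafR n ⟨2 * i, hlt0⟩, parentV (leafR n ⟨2 * i + 1, hklt⟩),
      ?_, ?_, ?_, ?_, ?_, ?_⟩
    · exact adj_leafL_crossR_fst hn (σ₀ n) ⟨2 * i + 1, hklt⟩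
    · have := adj_leafL_crossR_snd hn (σ₀ n) ⟨2 * i + 1, hklt⟩
      rwa [crossR_σ₀_snd, finRotate_symm_mk hklt] at this
    · intro h; have := congrArg idx h; simp at this
    · intro h; have := congrArg Prod.fst h; simp at this
    · exact Graph.adj_parentV hn _ (by simp; omega)
    · rw [parentV_leafR_eq (i := ⟨2 * i + 1, hklt⟩) (j := ⟨2 * i, hlt0⟩)
        (by show (2 * i + 1) / 2 = 2 * i / 2; omega)]
      exact Graph.adj_parentV hn _ (by simp; omega)

/-- **Under `σ₀` the glue squares mark exactly the bottom two layers** (`1 ≤ n`). -/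
theorem onSquare_σ₀_iff (hn : 1 ≤ n) (v : Vertex n) :
    OnSquare (graph n (σ₀ n)) v ↔ n ≤ depth v + 1 := by
  constructor
  · intro h
    by_contra hlt
    exact not_onSquare_of_depth_add_two_le (σ₀ n) (by omega) h
  · intro h
    rcases Nat.lt_or_ge (depth v) n with h2 | h2
    · exact onSquare_σ₀_of_depth_succ_eq hn (by omega)
    · have hv : depth v = n := le_antisymm (depth_le v) h2
      obtain ⟨i, rfl | rfl⟩ := exists_eq_leaf hv
      · exact onSquare_σ₀_leafL hn i
      · exact onSquare_σ₀_leafR hn i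

/-- **Bottom squares are an altimeter, for ANY cycle datum that has them** (§1c with `m = n - 1`,
`R = OnSquare`): if every vertex of depth `n - 1` lies on a square, then at `x` of depth
`1 ≤ j ≤ n - 2` entered from a known child, one non-backtracking walk of `n - 1 - j` edges from `x`
through a candidate `y` ends on a square iff `y` is the other child (the "only if" half needs no
hypothesis on `σ`: `not_onSquare_of_depth_add_two_le`). -/
theorem altimeter_of_bottom_squares (hn : 1 ≤ n) (σ : CycleDatum n)
    (hσ₁ : ∀ v : Vertex n, depth v + 1 = n → OnSquare (graph n σ) v)
    {x : Vertex n} (hx : 1 ≤ depth x) (hx₂ : depth x + 2 ≤ n)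
    (w : ℕ → Vertex n) (h0 : w 0 = x)
    (hadj : ∀ i, i < n - 1 - depth x → (graph n σ).Adj (w i) (w (i + 1)))
    (hnb : ∀ i, i + 2 ≤ n - 1 - depth x → w (i + 2) ≠ w i) :
    ((∃ b, w 1 = childV x b) → OnSquare (graph n σ) (w (n - 1 - depth x))) ∧
      (w 1 = parentV x → ¬ OnSquare (graph n σ) (w (n - 1 - depth x))) :=
  Altimeter.altimeter σ (m := n - 1) (by omega) {v | OnSquare (graph n σ) v}
    (fun v hv _ => hσ₁ v (by omega))
    (fun v hv => by
      by_contra h'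
      exact not_onSquare_of_depth_add_two_le σ (v := v) (by omega) hv)
    hx (by omega) w h0 hadj hnb

/-- **Orientation one level above the leaves, for any cycle datum with bottom squares** (`2 ≤ n`):
at `x` of depth `n - 1` the parent is the unique neighbour OFF the squares (the children are
leaves, on squares by hypothesis; the parent has depth `n - 2`). -/
theorem orientation_pred_of_bottom_squares (hn : 2 ≤ n) (σ : CycleDatum n)
    (hσ₂ : ∀ v : Vertex n, depth v = n → OnSquare (graph n σ) v)
    {x y : Vertex n} (hx : depth x + 1 = n) (hy : (graph n σ).Adj x y) :
    ¬ OnSquare (graph n σ) y ↔ y = parentV x := by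
  rcases Altimeter.adj_cases σ (by omega) hy with ⟨-, rfl⟩ | ⟨b, rfl⟩
  · refine ⟨fun _ => rfl, fun _ => not_onSquare_of_depth_add_two_le σ ?_⟩
    rw [depth_parentV]; omega
  · constructor
    · intro h; exact absurd (hσ₂ _ (by rw [depth_childV (by omega)]; omega)) h
    · intro h
      have := congrArg depth h
      rw [depth_childV (by omega), depth_parentV] at this
      omega

/-- **Orientation at the entry leaf, for any cycle datum with bottom squares** (`2 ≤ n`): at a
right leaf the parent is the unique neighbour having a neighbour OFF the squares (its own parent,
depth `n - 2`); the two cross neighbours are left leaves all of whose neighbours (a vertex of depth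
`n - 1`, two leaves) are on squares. -/
theorem leaf_orientation_of_bottom_squares (hn : 2 ≤ n) (σ : CycleDatum n)
    (hσ₁ : ∀ v : Vertex n, depth v + 1 = n → OnSquare (graph n σ) v)
    (hσ₂ : ∀ v : Vertex n, depth v = n → OnSquare (graph n σ) v)
    (k : Fin (2 ^ n)) {y : Vertex n} (hy : (graph n σ).Adj (leafR n k) y) :
    (∃ u, (graph n σ).Adj y u ∧ ¬ OnSquare (graph n σ) u) ↔ y = parentV (leafR n k) := by
  have hn1 : 1 ≤ n := by omega
  constructor
  · rintro ⟨u, hyu, hu⟩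
    rw [← SimpleGraph.mem_neighborFinset, neighborFinset_leafR hn1] at hy
    simp only [Finset.mem_insert, Finset.mem_singleton] at hy
    rcases hy with rfl | rfl | rfl
    · rfl
    all_goals
      exfalso
      rw [← SimpleGraph.mem_neighborFinset, neighborFinset_leafL hn1] at hyu
      simp only [Finset.mem_insert, Finset.mem_singleton] at hyu
      rcases hyu with rfl | rfl | rfl
      · exact hu (hσ₁ _ (by rw [depth_parentV, depth_leafL]; omega))
      · exact hu (hσ₂ _ (depth_leafR _))
      · exact hu (hσ₂ _ (depth_leafR _))
  · rintro rfl
    refine ⟨parentV (parentV (leafR n k)), Graph.adj_parentV hn1 _ (by simp; omega), ?_⟩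
    apply not_onSquare_of_depth_add_two_le σ
    simp only [depth_parentV, depth_leafR]
    omega

/-- **The squares are an altimeter for `σ₀`** (corollary of `altimeter_of_bottom_squares` and
`onSquare_σ₀_iff`). -/
theorem σ₀_altimeter (hn : 1 ≤ n) {x : Vertex n} (hx : 1 ≤ depth x) (hx₂ : depth x + 2 ≤ n)
    (w : ℕ → Vertex n) (h0 : w 0 = x)
    (hadj : ∀ i, i < n - 1 - depth x → (graph n (σ₀ n)).Adj (w i) (w (i + 1)))
    (hnb : ∀ i, i + 2 ≤ n - 1 - depth x → w (i + 2) ≠ w i) :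
    ((∃ b, w 1 = childV x b) → OnSquare (graph n (σ₀ n)) (w (n - 1 - depth x))) ∧
      (w 1 = parentV x → ¬ OnSquare (graph n (σ₀ n)) (w (n - 1 - depth x))) :=
  altimeter_of_bottom_squares hn (σ₀ n) (fun v hv => (onSquare_σ₀_iff hn v).2 (by omega))
    hx hx₂ w h0 hadj hnb

/-- **Orientation one level above the leaves** under `σ₀` (`2 ≤ n`). -/
theorem σ₀_orientation_pred (hn : 2 ≤ n) {x y : Vertex n} (hx : depth x + 1 = n)
    (hy : (graph n (σ₀ n)).Adj x y) : ¬ OnSquare (graph n (σ₀ n)) y ↔ y = parentV x :=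
  orientation_pred_of_bottom_squares hn (σ₀ n)
    (fun v hv => (onSquare_σ₀_iff (by omega) v).2 (by omega)) hx hy

/-- **Orientation at the entry leaf** under `σ₀` (`2 ≤ n`). -/
theorem σ₀_leaf_orientation (hn : 2 ≤ n) (k : Fin (2 ^ n)) {y : Vertex n}
    (hy : (graph n (σ₀ n)).Adj (leafR n k) y) :
    (∃ u, (graph n (σ₀ n)).Adj y u ∧ ¬ OnSquare (graph n (σ₀ n)) u) ↔ y = parentV (leafR n k) :=
  leaf_orientation_of_bottom_squares hn (σ₀ n)
    (fun v hv => (onSquare_σ₀_iff (by omega) v).2 (by omega))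
    (fun v hv => (onSquare_σ₀_iff (by omega) v).2 (by omega)) k hy

/-- Climbing keeps the side and reaches depth `0`; on the right, depth `0` is the EXIT
(`n` parent steps from a right leaf). -/
theorem iterate_parentV_leafR (k : Fin (2 ^ n)) :
    ∀ j, j ≤ n → ((fun v => parentV v)^[j] (leafR n k)).1 = true ∧
      depth ((fun v => parentV v)^[j] (leafR n k)) = n - j := by
  intro j
  induction j with
  | zero => intro _; simp
  | succ j ih =>
    intro hj
    obtain ⟨h1, h2⟩ := ih (by omega)
    rw [Function.iterate_succ_apply']
    exact ⟨by rw [parentV_fst, h1], by rw [depth_parentV, h2]; omega⟩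

/-- The climb from any right leaf ends at the EXIT after `n` parent steps. -/
theorem iterate_parentV_leafR_eq_exit (k : Fin (2 ^ n)) :
    (fun v => parentV v)^[n] (leafR n k) = GluedTrees.exit n := by
  obtain ⟨h1, h2⟩ := iterate_parentV_leafR (n := n) k n le_rfl
  rw [Vertex.ext_iff']
  refine ⟨h1, by rw [h2]; simp, ?_⟩
  have := idx_lt ((fun v => parentV v)^[n] (leafR n k))
  rw [h2, Nat.sub_self, pow_zero] at this
  show idx _ = 0
  omega

end StructuredCycle

/-! ## §2 Load-bearing hypothesis: ciphertext integrity of the names (no aliases)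

Abstract model of the item's example scheme `name(v) = (r(v), F(r(v)) ⊕ label(v), tag)` with the
integrity checks (tag verification, `r = F''(label)` re-derivation) DROPPED: names live in `R × L`
with `L` an additive group (bit strings under XOR), `name v = (r v, pad (r v) + lab v)` for a PUBLIC
injective labelling `lab` (the canonical vertex code — the adversary knows `lab (entrance n)` and
`lab (exit n)`, they are fixed strings) and arbitrary secret `r`, `pad` (PRF values). The
integrity-free decoder accepts every pair whose unmasked value is a label. Then the adversary
forges, from `name(ENTRANCE)` alone, a string that decodes to EXIT (`dec_forge`) although it is not
a canonical name (`forge_ne_name`, when `r` is injective as for `r = F''(label)` with an injective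
PRF slice): the neighbour circuit evaluated on it returns EXIT's two children; evaluated on a child
it returns three canonical names one of which is `name(EXIT)`, singled out by the degree-2 test
(`Graph.eq_exit_of_adj_child_exit`): `ans s` in at most `1 + 1 + 3 = 5` evaluations, probability 1.
So "reject unless canonical" (and a single fixed `⊥`) must be built into the typed `N_k`. -/

namespace Malleable

open GluedTrees

variable {n : ℕ} {R L : Type} [AddCommGroup L]

/-- Masked naming data: secret randomiser `r`, secret pad `pad` (PRF), public injective labels. -/
structure Scheme (n : ℕ) (R L : Type) [AddCommGroup L] where
  /-- The secret randomiser `r(v)` (e.g. `F''(label v)`). -/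
  r : Vertex n → R
  /-- The secret pad `F(r)`. -/
  pad : R → L
  /-- The PUBLIC injective labelling (canonical vertex code). -/
  lab : Vertex n ↪ L

/-- The name of a vertex: `(r v, pad (r v) + lab v)`. -/
def Scheme.name (S : Scheme n R L) (v : Vertex n) : R × L := (S.r v, S.pad (S.r v) + S.lab v)

open Classical in
/-- The integrity-free decoder: unmask and look the label up. -/
noncomputable def Scheme.dec (S : Scheme n R L) (a : R × L) : Option (Vertex n) :=
  if h : ∃ v, S.lab v = a.2 - S.pad a.1 then some h.choose else none

/-- The forgery: re-target the ENTRANCE's name at the EXIT using public labels only. -/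
def Scheme.forge (S : Scheme n R L) (aE : R × L) : R × L :=
  (aE.1, aE.2 - S.lab (entrance n) + S.lab (GluedTrees.exit n))

/-- Canonical names decode correctly. -/
theorem dec_name (S : Scheme n R L) (v : Vertex n) : S.dec (S.name v) = some v := by
  unfold Scheme.dec Scheme.name
  have hex : ∃ w, S.lab w = (S.pad (S.r v) + S.lab v) - S.pad (S.r v) := ⟨v, by abel⟩
  rw [dif_pos hex]
  congr 1
  apply S.lab.injective
  rw [hex.choose_spec]
  abel

/-- **The forged string decodes to EXIT.** -/
theorem dec_forge (S : Scheme n R L) : S.dec (S.forge (S.name (entrance n))) = some (GluedTrees.exit n) := by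
  unfold Scheme.dec Scheme.forge Scheme.name
  have hex : ∃ w, S.lab w =
      (S.pad (S.r (entrance n)) + S.lab (entrance n) - S.lab (entrance n) + S.lab (GluedTrees.exit n)) -
        S.pad (S.r (entrance n)) := ⟨GluedTrees.exit n, by abel⟩
  rw [dif_pos hex]
  congr 1
  apply S.lab.injective
  rw [hex.choose_spec]
  abel

/-- The forged string is NOT the canonical name of EXIT as soon as the randomisers of ENTRANCE and
EXIT differ (e.g. `r = F''(label)` injective): it is a genuine alias, invisible to any party that
only compares against canonical names, and rejected by an integrity-checking decoder. -/
theorem forge_ne_name (S : Scheme n R L) (hr : S.r (entrance n) ≠ S.r (GluedTrees.exit n)) :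
    S.forge (S.name (entrance n)) ≠ S.name (GluedTrees.exit n) := by
  intro h
  have := congrArg Prod.fst h
  exact hr this

/-- With an integrity-checking decoder (accept `a` only if `a = name v`), the forgery is rejected. -/
theorem canonical_rejects_forge (S : Scheme n R L) (hr : Function.Injective S.r) :
    ¬ ∃ v, S.forge (S.name (entrance n)) = S.name v := by
  rintro ⟨v, hv⟩
  have h1 : S.r (entrance n) = S.r v := congrArg Prod.fst hv
  have hvE : v = entrance n := (hr h1).symm
  subst hvE
  have h2 := congrArg Prod.snd hv
  simp only [Scheme.forge, Scheme.name] at h2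
  have : S.lab (GluedTrees.exit n) = S.lab (entrance n) := by
    have h3 : S.pad (S.r (entrance n)) + S.lab (entrance n) - S.lab (entrance n) + S.lab (GluedTrees.exit n)
        - (S.pad (S.r (entrance n)) + S.lab (entrance n)) = 0 := by rw [h2]; abel
    have h4 : S.pad (S.r (entrance n)) + S.lab (entrance n) - S.lab (entrance n) + S.lab (GluedTrees.exit n)
        - (S.pad (S.r (entrance n)) + S.lab (entrance n)) = S.lab (GluedTrees.exit n) - S.lab (entrance n) := by abel
    rw [h4] at h3
    exact sub_eq_zero.mp h3
  exact absurd (S.lab.injective this) (entrance_ne_exit n).symm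

end Malleable

/-! ## §3 Obstruction to the BPR15 plant-and-grow template: threshold-equals-degree percolation

The template (BitanskyPanethRosen2015, read this session: pp. 3–5 overview, p. 16 Claim 5.1, p. 17
Lemma 5.1) has two kinds of functionality-changing steps.
* PLANT (hidden trigger, "first step", p. 4): add `if PRG(index(input)) = v then ⊥` with `v` random
  (functionally inert: `v ∉ im PRG` w.h.p., iO), then `v := PRG(u)` for a RANDOM `u` (PRG security) —
  kills the vertex `u`. This step transfers verbatim to `G'_n` (index = label): any vertex drawn at
  random from a large set can be killed; a vertex with a PUBLIC label (EXIT, its children) cannot,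
  since `PRG(public label)` is publicly computable and the swap `v random → v = PRG(label)` is visible.
* GROW ("second step", pp. 4–5): kill `j+1` once `j` is dead — possible because "both circuits never
  output `PRF(j+1)`, but rather, on input `(j, PRF(j))` both return `⊥`. The value `PRF(j+1)` is only
  used to test if an input `(j+1, σ)` is valid", so it can be punctured and randomised. I.e. the rule:
  *the name of `v` can be punctured (and `v` killed) once every input on which the circuit OUTPUTS that
  name is already dead*. BPR themselves record that a second producer breaks it (p. 4: with the
  predecessor circuit "the signature `PRF(j+1)` can also be reached 'from the other direction'; namely,
  on input `(j+2, PRF(j+2))`, `P̃` does return `PRF(j+1)` in the clear") and evade it by CHANGING THE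
  OBJECT (p. 5: AKV04 reversible pebbling, both circuits derived from the one-directional `S̃`) — whose
  output is the verifiable line of crux `WbwVerifiableLineNoSpeedup`, quantumly inert.
For a directed successor circuit the unique producer of `x_{i+1}` is `x_i`, so one plant kills the
whole tail (`line_cascade`). For an undirected neighbour circuit every neighbour of `v` produces
`name(v)`, the growth rule is bootstrap percolation with threshold = degree, and NOTHING CASCADES: the
least growth-closed superset of the planted set `S` is reached in one round and equals
`S ∪ {v | N(v) ⊆ S}` (`sInter_isGrowthClosed_eq_oneRound`). For `G'_n`, EXIT dies only if it is
planted or BOTH its children are (`exit_mem_oneRound_iff`) — three public labels, unplantable by hidden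
triggers; `m` random plants among the `2^{n+2}-2` vertices achieve it with probability
`≤ m/(2^{n+2}-2) + (m/(2^{n+2}-2))²`. So every chain built from {iO-equivalence rewrites, PPRF
puncturing at unproduced names, hidden-trigger plants} leaves EXIT's name in the clear in every hybrid:
the formal half of the route's kill criterion (b). What is NOT excluded: steps of a new kind (the
ideators' nested-iO extraction, apex-swap decisional game) — they need an indistinguishability claim
for circuit pairs differing at publicly findable inputs, which iO alone does not supply (BCP14/Lemma 5.1
require the differing input to be hard to find GIVEN both circuits). -/

namespace Percolation

variable {V : Type*} (G : SimpleGraph V)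

/-- `T` is closed under the growth rule over the planted set `S`. -/
def IsGrowthClosed (S T : Set V) : Prop :=
  S ⊆ T ∧ ∀ v, (∃ w, G.Adj v w) → (∀ w, G.Adj v w → w ∈ T) → v ∈ T

/-- One round of growth from `S`. -/
def oneRound (S : Set V) : Set V :=
  S ∪ {v | (∃ w, G.Adj v w) ∧ ∀ w, G.Adj v w → w ∈ S}

/-- One round of growth is already growth-closed (no cascade). -/
theorem oneRound_isGrowthClosed (S : Set V) : IsGrowthClosed G S (oneRound G S) := by
  refine ⟨fun v hv => Or.inl hv, fun v hex hall => ?_⟩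
  by_cases hvS : v ∈ S
  · exact Or.inl hvS
  · refine Or.inr ⟨hex, fun w hw => ?_⟩
    rcases hall w hw with hwS | ⟨_, hwall⟩
    · exact hwS
    · -- `w` died in round one, so all its neighbours, `v` included, are planted
      exact absurd (hwall v hw.symm) hvS

/-- One round of growth is contained in every growth-closed superset of `S`. -/
theorem oneRound_subset_of_isGrowthClosed {S T : Set V} (h : IsGrowthClosed G S T) :
    oneRound G S ⊆ T := by
  rintro v (hv | ⟨hex, hall⟩)
  · exact h.1 hv
  · exact h.2 v hex fun w hw => h.1 (hall w hw)

/-- **The growth closure is one round**: the least growth-closed superset of `S` is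
`S ∪ {v | v has a neighbour and all its neighbours are in S}`. -/
theorem sInter_isGrowthClosed_eq_oneRound (S : Set V) :
    ⋂₀ {T | IsGrowthClosed G S T} = oneRound G S := by
  apply le_antisymm
  · exact Set.sInter_subset_of_mem (oneRound_isGrowthClosed G S)
  · exact Set.subset_sInter fun T hT => oneRound_subset_of_isGrowthClosed G hT

/-- The dead set generated by ANY sequence of steps: plants (`v ∈ S`) and growth steps (a vertex
with a neighbour, all of whose neighbours are already dead). -/
inductive Killed (S : Set V) : V → Prop
  | plant {v : V} (hv : v ∈ S) : Killed S v
  | grow {v : V} (hex : ∃ w, G.Adj v w) (hall : ∀ w, G.Adj v w → Killed S w) : Killed S v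

/-- **Any plant-and-grow sequence kills exactly one round**: `Killed G S v ↔ v ∈ oneRound G S`. -/
theorem killed_iff_mem_oneRound (S : Set V) (v : V) : Killed G S v ↔ v ∈ oneRound G S := by
  constructor
  · intro h
    induction h with
    | plant hv => exact Or.inl hv
    | grow hex _ ih => exact (oneRound_isGrowthClosed G S).2 _ hex ih
  · rintro (hv | ⟨hex, hall⟩)
    · exact Killed.plant hv
    · exact Killed.grow hex fun w hw => Killed.plant (hall w hw)

open GluedTrees in
/-- **For the glued trees**: EXIT is in the growth closure of a planted set `S` iff EXIT is planted
or BOTH children of EXIT are (`1 ≤ n`) — un-naming EXIT by growth steps forces a plant at publicly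
labelled positions adjacent to the answer. -/
theorem exit_mem_oneRound_iff {n : ℕ} (hn : 1 ≤ n) (σ : CycleDatum n) (S : Set (Vertex n)) :
    GluedTrees.exit n ∈ oneRound (graph n σ) S ↔
      GluedTrees.exit n ∈ S ∨ (childV (GluedTrees.exit n) false ∈ S ∧ childV (GluedTrees.exit n) true ∈ S) := by
  have h0 : depth (GluedTrees.exit n) < n := by simp; omega
  have hN : ∀ w, (graph n σ).Adj (GluedTrees.exit n) w ↔
      w = childV (GluedTrees.exit n) false ∨ w = childV (GluedTrees.exit n) true := by
    intro w
    rw [← SimpleGraph.mem_neighborFinset, neighborFinset_of_depth_lt σ h0, if_pos depth_exit]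
    simp
  unfold oneRound
  simp only [Set.mem_union, Set.mem_setOf_eq]
  constructor
  · rintro (h | ⟨_, hall⟩)
    · exact Or.inl h
    · exact Or.inr ⟨hall _ ((hN _).2 (Or.inl rfl)), hall _ ((hN _).2 (Or.inr rfl))⟩
  · rintro (h | ⟨h1, h2⟩)
    · exact Or.inl h
    · refine Or.inr ⟨⟨_, (hN _).2 (Or.inl rfl)⟩, fun w hw => ?_⟩
      rcases (hN w).1 hw with rfl | rfl
      · exact h1
      · exact h2

/-- Directed growth (BPR's setting): `T` is closed if every vertex that HAS producers and all of whose
producers are dead is dead. -/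
def IsGrowthClosedDir (P : V → V → Prop) (S T : Set V) : Prop :=
  S ⊆ T ∧ ∀ v, (∃ w, P w v) → (∀ w, P w v → w ∈ T) → v ∈ T

/-- **Contrast: the directed line cascades.** On `0 → 1 → 2 → ⋯` (unique producer = predecessor),
every growth-closed superset of the single plant `{j}` contains the whole tail `{i | j ≤ i}` — BPR's
`T` cheap growth steps after one costly plant (Claim 5.1). -/
theorem line_cascade (j : ℕ) (T : Set ℕ)
    (h : IsGrowthClosedDir (fun i k : ℕ => k = i + 1) {j} T) :
    ∀ i : ℕ, j ≤ i → i ∈ T := by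
  intro i hi
  induction i with
  | zero =>
    have hj : j = 0 := by omega
    subst hj
    exact h.1 rfl
  | succ i ih =>
    rcases Nat.lt_or_eq_of_le hi with hlt | heq
    · have hi' : i ∈ T := ih (by omega)
      refine h.2 (i + 1) ⟨i, rfl⟩ fun w hw => ?_
      obtain rfl : w = i := by
        simp only at hw
        omega
      exact hi'
    · rw [← heq]
      exact h.1 rfl

end Percolation

/-! ## §5 Why the hypotheses AS STATED resist PROOF: the quantum shadow of a black-box chain

Ideator 2's §A (BARRIER-NOTES-ideator2.md), formal core. A proof of (C) by a hybrid chain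
`W_0 → ⋯ → W_T` in which step `i` is justified by a reduction `R_i[A]` that (a) targets an assumption
also made against QUANTUM polynomial-time adversaries (iO, OWF, injective OWF, puncturable PRF, PRG —
every GENERIC primitive in the crux's hypothesis list is "post-quantum-possible") and (b) uses `A`
only as a black box on freshly sampled inputs, bounds the success of the quantum walker `Q` as well:
`Pr[Q wins in W_T] ≥ Pr[Q wins in W_0] − Σ δ_i ≥ (1 − ε)/(2(n+1)) − negl` (ChildsEtAl2003 Thm 3 via
the route's support item WbwSuccinctWalk). So no such chain can end in a world where `name(EXIT)`
is absent from the adversary's view (there EVERY algorithm wins with probability `≤ 2^{-|name|}`):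
`no_erasing_terminal`. Consequence for provers: the terminal step must be classical-only — a
simulation/query step for a white-box adversary (none is known), an explicitly PRE-quantum assumption
consumed whole-instance, or a non-black-box use of `A`. This is why "subexp iO + injective OWF +
PPRF ⇒ (C)" resists proof by punctured programming / BCP extraction / leveraging / KLW, all of which
satisfy (a) and (b); it is NOT evidence that (C) is false. -/

namespace QuantumShadow

/-- **Telescoping along a hybrid chain**: if consecutive worlds are `δ_i`-close for the adversary
at hand, its success in the last world is at least its success in the first minus `Σ δ_i`. -/
theorem chain_lower_bound (p δ : ℕ → ℝ) (T : ℕ) (h : ∀ i, i < T → |p i - p (i + 1)| ≤ δ i) :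
    p 0 - ∑ i ∈ Finset.range T, δ i ≤ p T := by
  induction T with
  | zero => simp
  | succ T ih =>
    have h1 := ih fun i hi => h i (by omega)
    have h2 := (abs_sub_le_iff.1 (h T (by omega))).1
    rw [Finset.sum_range_succ]
    linarith

/-- **No erasing terminal world.** If the chain's steps are `δ_i`-close for a class of adversaries
containing one (the quantum walker) that wins with probability `≥ q₀` in the real world, and in the
terminal world nobody wins with probability `> η`, then `Σ δ_i ≥ q₀ − η`: a chain with
`Σ δ_i = o(1)` (e.g. `2^{O(n^ε)}` steps of gap `2^{-λ^ε}`, `λ^ε ≫ n^ε`) never reaches an answer-free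
world while the quantum walker's `q₀ ≥ (1-ε)/(2(n+1))` stands. -/
theorem no_erasing_terminal (p δ : ℕ → ℝ) (T : ℕ) (q₀ η : ℝ)
    (h : ∀ i, i < T → |p i - p (i + 1)| ≤ δ i) (h0 : q₀ ≤ p 0) (hT : p T ≤ η) :
    q₀ - η ≤ ∑ i ∈ Finset.range T, δ i := by
  have := chain_lower_bound p δ T h
  linarith

end QuantumShadow

/-! ## §6 Targets (cycle 3): the registered skeleton `Lines/knowledge-of-walk-split.lean`

The line's three stubs `stub_split`, `stub_obfuscationMonotone`, `stub_bestPossibleStep`, its target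
`KnowledgeTransfer` and its bridge `cruxShape_of_knowledgeTransfer` were attacked as the cycle's targets
(payload `targets` empty; the skeleton is registered and checked). The `Lines/` work file is not an importable
module, so the objects attacked are COPIED VERBATIM below (`Targets.genObf`, `Targets.LineData.Admissible`,
`Targets.BestPossibleStep`, `Targets.ObfuscationMonotone`, …): every statement proved about a copy is, symbol
for symbol, the statement about the skeleton's declaration.

FINDINGS.
* `stub_split` — TRUE as typed (checked on paper against `RandAlg.pr`/`uniformProb`/`IsPolyTime`: the word
  finder `⟨fun z r => E (boolPair z r), A.coinLen⟩` is PPT by re-indexing `E`'s machine along `boolPair`, its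
  coin budget is `A`'s; union bound pointwise in the coin string; `Coherent` turns `ans s <+: y` into
  `nameOf y = ans s`). No attack. Not a target any more.
* `stub_obfuscationMonotone` — true for POLYNOMIAL-LENGTH clear instances (the obfuscated instance is an
  efficient function of the clear one and of INDEPENDENT uniform coins; guess the coin counts, polynomial
  loss); this seat found no attack, but the parallel drefute seat (refuter-drefute-stmt-QuantumAdvantage-2340-0,
  evidence `stub_obfuscationMonotone.md`, `CoinLengthAdvice.lean` = Negative VII) did: AS FILED the clear
  circuits `C k` may have SUPERPOLYNOMIAL code length, and in the `RandAlg` model a PPT's (poly-bounded, not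
  computable) coin budget is an `O(log L)`-bit advice channel indexed by ITS OWN input length — an efficient
  padding obfuscator makes `|genObf instance|` encode key bits that the coin-counting adversary reads w.p. 1,
  while the re-obfuscating simulator's guessing loss `1/q(|z|)` is superpolynomial in `n` and a diagonal
  answer table keeps `ClauseC (genClear …)`; repair: `∃ q, ∀ s, |genClear h m C nm s| ≤ q(|s|)`. COMMON ROOT with
  (T-a): unbounded INSTANCE LENGTH (there `nm`, here `C`) versus hardness measured in the seed length `n`.
* (T-b) `Targets.not_admissible_of_coinLen_pos`, `Targets.hadm_unsatisfiable`,
  `Targets.coinClause_unsatisfiable_of_coinLen_pos`: the seed-budget coin discipline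
  `∀ s, O.coins (κ |s|) (C_b (s.take (h |s|))) ≤ |s| − h |s|` (last conjunct of `LineData.Admissible`, and a
  HYPOTHESIS of both iO stubs) forces at `s = []` a ZERO coin budget `O.coinLen ℓ₀ = 0` at an input length
  `ℓ₀ ≥ 2`. Hence every obfuscator tossing ≥ 1 coin on every input is admissible for NO line datum, the two iO
  stubs are VACUOUS for it, and the bridge hypothesis `hadm` (admissibility for ALL sub-exp iO, with an
  `O`-independent datum) is unsatisfiable as soon as one sub-exp iO with positive coin budget exists — i.e. as
  soon as any exists (pad one ignored coin), while without one `CruxShape` is vacuous (`cruxShape_of_no_subexpIO`):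
  the §5 bridge of the skeleton can only be applied vacuously. `Targets.admissible_forces_sublinear_kappa`: for
  an obfuscator using ≥ κ coins at level κ the clause forces `κ n ≤ n − h n` at EVERY length (cycle-1 trap T2,
  seed budget, re-entering), against `κ n ≥ m k + |C₀ k|` from `ppolyCircuits`. REPAIR (stub-misstated): make the
  coin clause eventual (`∃ n₀, ∀ s, n₀ ≤ |s| → …`) and let the line datum / schedule depend on `O`
  (`𝓛 O P f c`; `GenType` already takes `O`), or PRG-stretch the seed. Evidence note
  `Negative-notes/Admissible-coin-discipline.md`.
* (T-a) `stub_bestPossibleStep` (and `LineData`: fields `nm`, `ans`) carries NO LENGTH BOUND on `nm`, `ans`,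
  while `ClauseC` adversaries are PPT in `|⟨1ⁿ, ⟨code, nm k⟩⟩|`. With `|nm k| = 2^{Q(n)} > 2^{(κ n)^ε}` the
  docstring proof dies (advice `(1ⁿ, nm k, ans k)` exceeds `t κ = 2^{κ^ε}`; no PPT distinguisher can even write
  `A`'s input), and the padded adversary runs in time `poly(2^{Q(n)})`: under the crux's OWN hypotheses
  (sub-exp iO + sub-exp-hard injective OWF ⇒ a dead-code-LEAKY sub-exp iO `O'`: append a perfectly binding,
  sub-exp hiding commitment of the input circuit as dead wiring) the statement WITH the coin clause repaired is
  FALSE: `C₀ (k₁,k₂)` = a fixed circuit with `k₂` in dead wiring, `C₁` = the same with zeros, `ans = k₂`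
  (information-theoretically hidden in world 1: success ≤ `2^{-|k₂|}` for EVERY algorithm), `nm` = padding;
  in world 0 the padded PPT opens the commitment by brute force and outputs `k₂` with probability 1. (As
  LITERALLY typed the stub is protected from this witness only by the vacuity (T-b) at `s = []`.) In print:
  Goldwasser–Rothblum, *On best-possible obfuscation* (TCC 2007) — iO is best-possible RELATIVE TO THE
  DISTINGUISHER CLASS only; an efficient statistically best-possible obfuscator already for 3-CNF collapses PH.
  REPAIR (stub-misstated): add `∃ p, ∀ s, |nm (s.take (h |s|))| ≤ p(|s|) ∧ |ans (s.take (h |s|))| ≤ p(|s|)` to the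
  stub and to `Admissible`; then `keyed_family_subexp` applies as the docstring says. Evidence note
  `Negative-notes/stub_bestPossibleStep.md`. Not formalised: a Lean `¬` needs an iO instance (§0
  `not_cruxShape_imp` logic); the information-theoretic half is `Targets.prefix_hit_card_le_one` below.
* (T-d) THE REFERENCE-OBFUSCATOR DILEMMA (remark, no formal content). The line pins KWA₀ ∧ WordHard₀ to the
  clear reference family `C₁ k̃ = pad_S(O₀(N_k; r₀))` for "ONE fixed obfuscator `O₀`". Three constraints
  collide: (i) `O₀` must not be the universally quantified `O` — else KWA₀ is the `∀O`-KWA that TRIAGE-r1-3's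
  gadget obfuscator (`O* = O +` obfuscated dead deep-name sampler) makes inconsistent with (iO ∧ PPRF ∧ the
  path-hardness bet); (ii) `O₀` must HIDE the naming keys — with `O₀ =` identity (or any key-leaking map)
  `WordHard₀` is false by §1's role walk after decryption (`RoleOrder.roleWalk_eq_exit`) and `ClauseC 𝓛.gen₀`
  is false outright; (iii) in `cruxShape_of_knowledgeTransfer` the datum `𝓛 P f c` (hence `C₁`, hence `O₀`)
  is a CLOSED function of `(P, f, c)` — a key-hiding obfuscator built from a puncturable PRF and an injective
  OWF alone is not available in print (iO from OWF-type primitives is not known), and no concrete candidate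
  obfuscator is a term of the tree. So the only coherent typing of the antecedents is EXISTENTIAL:
  `∃ O₀, IsSubexpIO ε' ppolyCircuits O₀ ∧ KWA₀(O₀) ∧ WordHard₀(O₀)` (consistent with ideal-obfuscation
  heuristics; `∀ O₀` is gadget-false, a specific `O₀` is unavailable), with `𝓛` depending on that `O₀` (and,
  by (T-b), on `O`). Recorded for the lead/planner; nothing to refute until `obfuscatedGluedTreesGen` fixes `O₀`.
-/

namespace Targets

/-! ### Verbatim copies of the skeleton's objects (Lines/knowledge-of-walk-split.lean §1–§4) -/

/-- Copy of the skeleton's `WalkModel` (fields only; needed as a field of `LineData`). -/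
structure WalkModel where
  /-- name of the ENTRANCE carried by the instance -/
  entrance : List Bool → List Bool
  /-- the common length of vertex names of the instance -/
  nameLen : List Bool → ℕ
  /-- neighbour listing of the instance on a name (`none` on invalid names) -/
  nbrs : List Bool → List Bool → Option (List (List Bool))

/-- Copy of the skeleton's `genObf`. -/
def genObf (O : CircuitObfuscator) (κ h : ℕ → ℕ) (m : List Bool → ℕ)
    (C : (k : List Bool) → Circuit (Fin (m k))) (nm : List Bool → List Bool) (s : List Bool) :
    List Bool :=
  boolPair
    (encodeSizedCircuit ⟨m (s.take (h s.length)),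
      O.obf (κ s.length) (C (s.take (h s.length)))
        ((s.drop (h s.length)).take (O.coins (κ s.length) (C (s.take (h s.length)))))⟩)
    (nm (s.take (h s.length)))

/-- Copy of the skeleton's `genClear`. -/
def genClear (h : ℕ → ℕ) (m : List Bool → ℕ) (C : (k : List Bool) → Circuit (Fin (m k)))
    (nm : List Bool → List Bool) (s : List Bool) : List Bool :=
  boolPair (encodeSizedCircuit ⟨m (s.take (h s.length)), C (s.take (h s.length))⟩)
    (nm (s.take (h s.length)))

/-- Copy of the skeleton's `keyed`. -/
def keyed (h : ℕ → ℕ) (ans : List Bool → List Bool) (s : List Bool) : List Bool :=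
  ans (s.take (h s.length))

/-- Copy of the skeleton's `ObfuscationMonotone` (statement of `stub_obfuscationMonotone`). -/
def ObfuscationMonotone : Prop :=
  ∀ (O : CircuitObfuscator), O.IsEfficient →
  ∀ (κ h : ℕ → ℕ) (m : List Bool → ℕ) (C : (k : List Bool) → Circuit (Fin (m k)))
    (nm ans : List Bool → List Bool),
    PolyTimeComputable Computability.unaryEncodeNat Computability.unaryEncodeNat κ →
    (∃ p : Polynomial ℕ, ∀ n, κ n ≤ p.eval n) → (∀ n, h n ≤ n) →
    (∀ s : List Bool, O.coins (κ s.length) (C (s.take (h s.length))) ≤ s.length - h s.length) →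
    ClauseC (genClear h m C nm) (keyed h ans) →
    ClauseC (genObf O κ h m C nm) (keyed h ans)

/-- Copy of the skeleton's `BestPossibleStep` (statement of `stub_bestPossibleStep`). -/
def BestPossibleStep : Prop :=
  ∀ (ε : ℝ) (O : CircuitObfuscator), 0 < ε → IsSubexpIO ε ppolyCircuits O →
  ∀ (κ h : ℕ → ℕ) (m : List Bool → ℕ) (C₀ C₁ : (k : List Bool) → Circuit (Fin (m k)))
    (nm ans : List Bool → List Bool),
    (∃ c : ℝ, 0 < c ∧ ∀ᶠ n : ℕ in atTop, (n : ℝ) ^ c ≤ κ n) →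
    (∃ p : Polynomial ℕ, ∀ n, κ n ≤ p.eval n) → (∀ n, h n ≤ n) →
    (∀ s : List Bool,
        (⟨m (s.take (h s.length)), C₀ (s.take (h s.length))⟩ : SizedCircuit) ∈
            ppolyCircuits (κ s.length) ∧
        (⟨m (s.take (h s.length)), C₁ (s.take (h s.length))⟩ : SizedCircuit) ∈
            ppolyCircuits (κ s.length) ∧
        (C₀ (s.take (h s.length))).size = (C₁ (s.take (h s.length))).size ∧
        (∀ x, (C₀ (s.take (h s.length))).eval x = (C₁ (s.take (h s.length))).eval x) ∧
        O.coins (κ s.length) (C₀ (s.take (h s.length))) ≤ s.length - h s.length ∧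
        O.coins (κ s.length) (C₁ (s.take (h s.length))) ≤ s.length - h s.length) →
    ClauseC (genObf O κ h m C₁ nm) (keyed h ans) →
    ClauseC (genObf O κ h m C₀ nm) (keyed h ans)

/-- Copy of the skeleton's `LineData`. -/
structure LineData where
  /-- security parameter fed to the obfuscator at seed length `n` -/
  κ : ℕ → ℕ
  /-- number of seed bits used as key material -/
  h : ℕ → ℕ
  /-- arity of the neighbour circuit for key `k` -/
  m : List Bool → ℕ
  /-- the canonical (padded) neighbour circuit -/
  C₀ : (k : List Bool) → Circuit (Fin (m k))
  /-- the O-free reference circuit -/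
  C₁ : (k : List Bool) → Circuit (Fin (m k))
  /-- name of the ENTRANCE for key `k` -/
  nm : List Bool → List Bool
  /-- the answer for key `k` -/
  ans : List Bool → List Bool
  /-- walk semantics of the instances -/
  M : WalkModel

namespace LineData

/-- Copy of the skeleton's `LineData.gen₀`. -/
def gen₀ (𝓛 : LineData) : List Bool → List Bool := genClear 𝓛.h 𝓛.m 𝓛.C₁ 𝓛.nm

/-- Copy of the skeleton's `LineData.gen`. -/
def gen (𝓛 : LineData) (O : CircuitObfuscator) : List Bool → List Bool := genObf O 𝓛.κ 𝓛.h 𝓛.m 𝓛.C₀ 𝓛.nm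

/-- Copy of the skeleton's `LineData.answer`. -/
abbrev answer (𝓛 : LineData) : List Bool → List Bool := keyed 𝓛.h 𝓛.ans

/-- Copy of the skeleton's `LineData.Admissible`. -/
def Admissible (𝓛 : LineData) (O : CircuitObfuscator) : Prop :=
  PolyTimeComputable Computability.unaryEncodeNat Computability.unaryEncodeNat 𝓛.κ ∧
  (∃ c : ℝ, 0 < c ∧ ∀ᶠ n : ℕ in atTop, (n : ℝ) ^ c ≤ 𝓛.κ n) ∧
  (∃ p : Polynomial ℕ, ∀ n, 𝓛.κ n ≤ p.eval n) ∧
  (∀ n, 𝓛.h n ≤ n) ∧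
  (∀ s : List Bool,
      (⟨𝓛.m (s.take (𝓛.h s.length)), 𝓛.C₀ (s.take (𝓛.h s.length))⟩ : SizedCircuit) ∈
          ppolyCircuits (𝓛.κ s.length) ∧
      (⟨𝓛.m (s.take (𝓛.h s.length)), 𝓛.C₁ (s.take (𝓛.h s.length))⟩ : SizedCircuit) ∈
          ppolyCircuits (𝓛.κ s.length) ∧
      (𝓛.C₀ (s.take (𝓛.h s.length))).size = (𝓛.C₁ (s.take (𝓛.h s.length))).size ∧
      (∀ x, (𝓛.C₀ (s.take (𝓛.h s.length))).eval x = (𝓛.C₁ (s.take (𝓛.h s.length))).eval x) ∧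
      O.coins (𝓛.κ s.length) (𝓛.C₀ (s.take (𝓛.h s.length))) ≤ s.length - 𝓛.h s.length ∧
      O.coins (𝓛.κ s.length) (𝓛.C₁ (s.take (𝓛.h s.length))) ≤ s.length - 𝓛.h s.length)

end LineData

/-! ### (T-b) The coin discipline at the empty seed -/

/-- The encoded obfuscator input `⟨1^κ, ⟨bin n, code C⟩⟩` is never shorter than `2` (the pairing separator). -/
theorem two_le_length_encodeInput (κ : ℕ) (C : SizedCircuit) :
    2 ≤ (CircuitObfuscator.encodeInput (κ, C)).length := by
  unfold CircuitObfuscator.encodeInput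
  rw [length_boolPair]
  omega

/-- **Admissibility forces a ZERO coin budget at the empty seed**: `O.coins (κ 0) (C_b _) = 0` for both
families (the clause `coins ≤ |s| − h |s|` at `s = []`). -/
theorem admissible_coins_zero (𝓛 : LineData) (O : CircuitObfuscator) (h : 𝓛.Admissible O) :
    O.coins (𝓛.κ 0) (𝓛.C₀ (List.take (𝓛.h 0) [])) = 0 ∧
      O.coins (𝓛.κ 0) (𝓛.C₁ (List.take (𝓛.h 0) [])) = 0 := by
  obtain ⟨-, -, -, -, hs⟩ := h
  obtain ⟨-, -, -, -, h0, h1⟩ := hs []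
  simp only [List.length_nil, Nat.zero_sub, Nat.le_zero] at h0 h1
  exact ⟨h0, h1⟩

/-- **(T-b) An obfuscator whose coin budget is positive on every input of length `≥ 2` is admissible for NO
line datum.** In particular `KnowledgeTransfer` holds vacuously for it. -/
theorem not_admissible_of_coinLen_pos (O : CircuitObfuscator) (hO : ∀ ℓ, 2 ≤ ℓ → 1 ≤ O.coinLen ℓ)
    (𝓛 : LineData) : ¬ 𝓛.Admissible O := by
  intro h
  have h0 := (admissible_coins_zero 𝓛 O h).1
  unfold CircuitObfuscator.coins at h0
  have := hO _ (two_le_length_encodeInput (𝓛.κ 0) ⟨_, 𝓛.C₀ (List.take (𝓛.h 0) [])⟩)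
  omega

/-- **(T-b, bridge) The hypothesis `hadm` of the skeleton's `cruxShape_of_knowledgeTransfer` is
unsatisfiable** as soon as ONE sub-exponentially secure iO (for some `ε ∈ (0,1)`) with everywhere-positive coin
budget exists — which is the case as soon as any sub-exp iO exists (add one ignored coin). Without a sub-exp
iO, `CruxShape` is vacuous (`cruxShape_of_no_subexpIO`, §0): the bridge is applicable only vacuously. -/
theorem hadm_unsatisfiable
    (H : ∃ ε : ℝ, 0 < ε ∧ ε < 1 ∧ ∃ O, IsSubexpIO ε ppolyCircuits O ∧ ∀ ℓ, 2 ≤ ℓ → 1 ≤ O.coinLen ℓ)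
    (𝓛 : PuncturablePRFScheme → (List Bool → List Bool) → ℕ → LineData)
    (P : PuncturablePRFScheme) (f : List Bool → List Bool) (c : ℕ) :
    ¬ (∀ ε : ℝ, 0 < ε → ε < 1 → ∀ O : CircuitObfuscator, IsSubexpIO ε ppolyCircuits O →
      ∀ P f c, (𝓛 P f c).Admissible O) := by
  rintro hadm
  obtain ⟨ε, hε, hε1, O, hO, hcoin⟩ := H
  exact not_admissible_of_coinLen_pos O hcoin (𝓛 P f c) (hadm ε hε hε1 O hO P f c)

/-- **(T-b, stubs) The coin hypothesis shared by `stub_bestPossibleStep` and `stub_obfuscationMonotone` is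
unsatisfiable for every obfuscator with everywhere-positive coin budget** (whatever `κ h m C`): for such `O` both stubs hold VACUOUSLY; they carry content only for obfuscators whose coin budget
vanishes at the specific input length met at `s = []`. -/
theorem coinClause_unsatisfiable_of_coinLen_pos (O : CircuitObfuscator)
    (hO : ∀ ℓ, 2 ≤ ℓ → 1 ≤ O.coinLen ℓ) (κ h : ℕ → ℕ) (m : List Bool → ℕ)
    (C : (k : List Bool) → Circuit (Fin (m k))) :
    ¬ (∀ s : List Bool, O.coins (κ s.length) (C (s.take (h s.length))) ≤ s.length - h s.length) := by
  intro hs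
  have h0 := hs []
  simp only [List.length_nil, Nat.zero_sub, Nat.le_zero] at h0
  unfold CircuitObfuscator.coins at h0
  have := hO _ (two_le_length_encodeInput (κ 0) ⟨_, C (List.take (h 0) [])⟩)
  omega

/-- **(T-b, every length) For an obfuscator using at least `κ` coins at security level `κ`** (every candidate
in print), admissibility forces a SUB-LINEAR security parameter `κ n ≤ n − h n` at every seed length — while
membership `C₀ k ∈ ppolyCircuits (κ n)` forces `κ n ≥ m k + |C₀ k|` (arity + size of the padded neighbour
circuit). Cycle-1 trap T2 (seed budget) in the skeleton's clothes. -/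
theorem admissible_forces_sublinear_kappa (O : CircuitObfuscator)
    (hO : ∀ (κ n : ℕ) (C : Circuit (Fin n)), κ ≤ O.coins κ C) (𝓛 : LineData) (h : 𝓛.Admissible O)
    (s : List Bool) :
    𝓛.m (s.take (𝓛.h s.length)) + (𝓛.C₀ (s.take (𝓛.h s.length))).size ≤ 𝓛.κ s.length ∧
      𝓛.κ s.length ≤ s.length - 𝓛.h s.length := by
  obtain ⟨-, -, -, -, hs⟩ := h
  obtain ⟨hmem, -, -, -, h0, -⟩ := hs s
  rw [mem_ppolyCircuits_iff] at hmem
  exact ⟨hmem.2, (hO _ _ _).trans h0⟩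

/-! ### (T-a) The information-theoretic half of the padding witness against `stub_bestPossibleStep`

World 1 of the witness: when the instance is independent of the answer `k₂ ∈ {0,1}^L`, every algorithm's
output `y` is hit by at most ONE of the `2^L` candidate answers (two distinct strings of the same length are
not both prefixes of `y`), so the success probability averaged over `k₂` is `≤ 2^{-L}` — for every adversary,
bounded or not. The combinatorial core: -/

/-- At most one string of a given length is a prefix of a given string. -/
theorem prefix_unique_of_length_eq {w w' y : List Bool} (hw : w <+: y) (hw' : w' <+: y)
    (hlen : w.length = w'.length) : w = w' := by
  rw [List.prefix_iff_eq_take] at hw hw'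
  rw [hw, hw', hlen]

/-- **The candidate answers hitting a fixed output form a set of size ≤ 1** (among all strings of length `L`). -/
theorem prefix_hit_card_le_one (L : ℕ) (y : List Bool) :
    (Finset.univ.filter fun w : List.Vector Bool L => w.toList <+: y).card ≤ 1 := by
  rw [Finset.card_le_one]
  intro a ha b hb
  rw [Finset.mem_filter] at ha hb
  have := prefix_unique_of_length_eq ha.2 hb.2 (by simp)
  exact List.Vector.toList_injective this

/-- Hence the uniform probability, over the answer `w ∈ {0,1}^L`, that `w` is a prefix of a FIXED output `y`
is at most `2^{-L}`: the world-1 bound of the padding witness, for every (even unbounded) adversary whose view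
is independent of `w`. -/
theorem uniformProb_prefix_le (L : ℕ) (y : List Bool) :
    uniformProb L {w | w <+: y} ≤ 1 / 2 ^ L := by
  unfold uniformProb
  rw [div_le_div_iff_of_pos_right (by positivity), Nat.cast_le_one, Finset.card_le_one]
  intro a ha b hb
  simp only [Finset.mem_filter, Finset.mem_univ, true_and, Set.mem_setOf_eq] at ha hb
  exact List.Vector.toList_injective (prefix_unique_of_length_eq ha hb (by simp))

/-! ### (T-b, made unconditional) Coin padding: the bridge hypothesis `hadm` ALONE proves `CruxShape`

Given ANY obfuscator `O`, `padCoin O` ("one extra, ignored last coin": `obf' κ C r = obf κ C r.dropLast`,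
`coinLen' = coinLen + 1`) has the SAME obfuscation law (`padCoin_obfPMF`, via
`PRGTrunc.uniformBits_succ_map_dropLast`), hence the same functionality, slowdown and `(t,δ)`-security,
and it is efficient when `O` is (`padCoin_isEfficient`: `O`'s machine after the polynomial-time
preprocessing `⟨u, r⟩ ↦ ⟨u, r.dropLast⟩`, `mapSndFn dropLast ∈ FP`). So `IsSubexpIO ε 𝒞 O → IsSubexpIO ε 𝒞
(padCoin O)` (`padCoin_isSubexpIO`) with `1 ≤ coinLen'` everywhere; with `not_admissible_of_coinLen_pos`:
`hadm` ⇒ no sub-exp iO exists for any `ε ∈ (0,1)` ⇒ `CruxShape obfGen` for EVERY `obfGen`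
(`cruxShape_of_hadm`), i.e. **the skeleton's bridge `cruxShape_of_knowledgeTransfer` needs none of
`KnowledgeTransfer`, `hgen`, `hcoh`, `hKW`: its admissibility hypothesis already implies its conclusion.**
Unconditional; no `H`. -/

namespace CoinPad

/-- `O` with ONE extra, ignored last coin. -/
def padCoin (O : CircuitObfuscator) : CircuitObfuscator where
  obf := fun κ {_} C r => O.obf κ C r.dropLast
  coinLen := fun ℓ => O.coinLen ℓ + 1

variable (O : CircuitObfuscator)

@[simp] theorem padCoin_coinLen (ℓ : ℕ) : (padCoin O).coinLen ℓ = O.coinLen ℓ + 1 := rfl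

@[simp] theorem padCoin_obf (κ : ℕ) {n : ℕ} (C : Circuit (Fin n)) (r : List Bool) :
    (padCoin O).obf κ C r = O.obf κ C r.dropLast := rfl

theorem padCoin_coins (κ : ℕ) {n : ℕ} (C : Circuit (Fin n)) :
    (padCoin O).coins κ C = O.coins κ C + 1 := rfl

theorem one_le_padCoin_coinLen (ℓ : ℕ) : 1 ≤ (padCoin O).coinLen ℓ := by
  rw [padCoin_coinLen]; omega

/-- **Same obfuscation law** (`U_{c+1}` without its last bit is `U_c`). -/
theorem padCoin_obfPMF (κ : ℕ) {n : ℕ} (C : Circuit (Fin n)) :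
    (padCoin O).obfPMF κ C = O.obfPMF κ C := by
  unfold CircuitObfuscator.obfPMF
  rw [padCoin_coins]
  have h : (padCoin O).obf κ C = (O.obf κ C) ∘ List.dropLast := by
    funext r; rfl
  rw [h, ← PMF.map_comp, PRGTrunc.uniformBits_succ_map_dropLast]

theorem padCoin_obfCodePMF (κ : ℕ) {n : ℕ} (C : Circuit (Fin n)) :
    (padCoin O).obfCodePMF κ C = O.obfCodePMF κ C := by
  unfold CircuitObfuscator.obfCodePMF
  rw [padCoin_obfPMF]

theorem padCoin_ioAdvantageAdv (D : RandAlg (List Bool) Bool) (a : ℕ → List Bool) (κ : ℕ) {n : ℕ}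
    (C₀ C₁ : Circuit (Fin n)) :
    (padCoin O).ioAdvantageAdv D a κ C₀ C₁ = O.ioAdvantageAdv D a κ C₀ C₁ := by
  unfold CircuitObfuscator.ioAdvantageAdv
  rw [padCoin_obfCodePMF, padCoin_obfCodePMF]

theorem padCoin_preservesFunctionality {𝒞 : ℕ → Set SizedCircuit} (h : O.PreservesFunctionality 𝒞) :
    (padCoin O).PreservesFunctionality 𝒞 := by
  intro κ n C hC C' hC'
  rw [padCoin_obfPMF] at hC'
  exact h κ n C hC C' hC'

theorem padCoin_hasPolySlowdown {𝒞 : ℕ → Set SizedCircuit} (h : O.HasPolySlowdown 𝒞) :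
    (padCoin O).HasPolySlowdown 𝒞 := by
  obtain ⟨p, hp⟩ := h
  refine ⟨p, fun κ n C hC C' hC' => ?_⟩
  rw [padCoin_obfPMF] at hC'
  exact hp κ n C hC C' hC'

theorem padCoin_isSecureIndistinguishable {t δ : ℕ → ℝ} {𝒞 : ℕ → Set SizedCircuit}
    (h : O.IsSecureIndistinguishable t δ 𝒞) : (padCoin O).IsSecureIndistinguishable t δ 𝒞 := by
  intro D hD a ha
  filter_upwards [h D hD a ha] with κ hκ n C₀ C₁ h₀ h₁ hs he
  rw [padCoin_ioAdvantageAdv]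
  exact hκ n C₀ C₁ h₀ h₁ hs he

/-- **The padded obfuscator is efficient**: `O`'s machine after `⟨u, r⟩ ↦ ⟨u, r.dropLast⟩`
(`mapSndFn dropLast ∈ FP`, transported along the input encoding; `PolyTimeComputable.comp_holds`),
coin budget bounded by `p + 1`. -/
theorem padCoin_isEfficient (h : O.IsEfficient) : (padCoin O).IsEfficient := by
  obtain ⟨hrun, p, hp⟩ := h
  refine ⟨?_, p + 1, fun ℓ => ?_⟩
  · have hpre : PolyTimeComputable
        (fun pr : (ℕ × SizedCircuit) × List Bool => boolPair (CircuitObfuscator.encodeInput pr.1) pr.2)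
        (fun pr : (ℕ × SizedCircuit) × List Bool => boolPair (CircuitObfuscator.encodeInput pr.1) pr.2)
        (fun pr : (ℕ × SizedCircuit) × List Bool => (pr.1, pr.2.dropLast)) :=
      PolyTimeComputable.of_encode_eq (f := mapSndFn fun l : List Bool => l.dropLast)
        (fun pr : (ℕ × SizedCircuit) × List Bool => boolPair (CircuitObfuscator.encodeInput pr.1) pr.2)
        (fun _ => rfl) (fun pr => by simp) (mapSndFn_mem_FP PRGTrunc.dropLast_mem_FP)
    have hcomp := PolyTimeComputable.comp_holds hrun hpre
    have heq : (Function.uncurry O.toRandAlg.run) ∘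
        (fun pr : (ℕ × SizedCircuit) × List Bool => (pr.1, pr.2.dropLast)) =
        Function.uncurry (padCoin O).toRandAlg.run := by
      funext pr
      rfl
    rw [heq] at hcomp
    exact hcomp
  · show O.coinLen ℓ + 1 ≤ (p + 1).eval ℓ
    rw [Polynomial.eval_add, Polynomial.eval_one]
    exact Nat.add_le_add_right (hp ℓ) 1

/-- **Coin padding preserves sub-exponential iO security** (any class, any `ε`). -/
theorem padCoin_isSubexpIO {ε : ℝ} {𝒞 : ℕ → Set SizedCircuit} (h : IsSubexpIO ε 𝒞 O) :
    IsSubexpIO ε 𝒞 (padCoin O) :=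
  ⟨padCoin_isEfficient O h.isEfficient, padCoin_preservesFunctionality O h.preserves,
    padCoin_hasPolySlowdown O h.slowdown, padCoin_isSecureIndistinguishable O h.indist⟩

/-- A sub-exp iO for `P/poly` exists iff one with everywhere-positive coin budget exists. -/
theorem subexpIOExist_iff_pos_coins (ε : ℝ) :
    SubexpIOExist ε ↔ ∃ O, IsSubexpIO ε ppolyCircuits O ∧ ∀ ℓ, 1 ≤ O.coinLen ℓ := by
  constructor
  · rintro ⟨O, hO⟩
    exact ⟨padCoin O, padCoin_isSubexpIO O hO, one_le_padCoin_coinLen O⟩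
  · rintro ⟨O, hO, -⟩
    exact ⟨O, hO⟩

end CoinPad

/-- **(T-b, unconditional) One sub-exp iO (any `ε ∈ (0,1)`) already refutes the bridge hypothesis
`hadm`** of `cruxShape_of_knowledgeTransfer`: pad its coins and apply `not_admissible_of_coinLen_pos`. -/
theorem hadm_false_of_isSubexpIO {ε : ℝ} (hε : 0 < ε) (hε1 : ε < 1) {O : CircuitObfuscator}
    (hO : IsSubexpIO ε ppolyCircuits O)
    (𝓛 : PuncturablePRFScheme → (List Bool → List Bool) → ℕ → LineData)
    (P : PuncturablePRFScheme) (f : List Bool → List Bool) (c : ℕ) :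
    ¬ (∀ ε : ℝ, 0 < ε → ε < 1 → ∀ O : CircuitObfuscator, IsSubexpIO ε ppolyCircuits O →
      ∀ P f c, (𝓛 P f c).Admissible O) := fun hadm =>
  not_admissible_of_coinLen_pos (CoinPad.padCoin O) (fun ℓ _ => CoinPad.one_le_padCoin_coinLen O ℓ)
    (𝓛 P f c) (hadm ε hε hε1 _ (CoinPad.padCoin_isSubexpIO O hO) P f c)

/-- **(T-b, headline) The bridge is vacuous: `hadm` ALONE implies `CruxShape obfGen` for EVERY
generator** — `KnowledgeTransfer`, the factorisation `hgen`, coherence and the antecedents KWA₀/WordHard₀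
are not needed. (`CruxShape` is §0's; `hadm` is verbatim the hypothesis of the skeleton's
`cruxShape_of_knowledgeTransfer`, over the verbatim copy `Targets.LineData.Admissible`.) -/
theorem cruxShape_of_hadm (𝓛 : PuncturablePRFScheme → (List Bool → List Bool) → ℕ → LineData)
    (hadm : ∀ ε : ℝ, 0 < ε → ε < 1 → ∀ O : CircuitObfuscator, IsSubexpIO ε ppolyCircuits O →
      ∀ P f c, (𝓛 P f c).Admissible O)
    (obfGen : GenType) : CruxShape obfGen := by
  intro ε hε hε1 O hO P _ f _ _ c _
  exact absurd hadm (hadm_false_of_isSubexpIO hε hε1 hO 𝓛 P f c)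

/-! ### Corrected signatures (elaborate; for the lead / planner to copy — the disprover edits no skeleton)

`Repaired.BestPossibleStep'` = the stub with (T-a) the length bounds on `nm`, `ans` and (T-b) the EVENTUAL coin
clause; `Repaired.Admissible'` = the admissibility predicate with the same two repairs. With them the docstring
proof of the stub goes through (`keyed_family_subexp`'s `hadv` is met: advice `(1ⁿ, nm k*, ans k*, coins)` has
length `poly(n) ≤ 2^{(κ n)^ε}` eventually), the `s = []` witness of `not_admissible_of_coinLen_pos` is gone, and
the bridge must additionally let the datum depend on `O` (`𝓛 O P f c`), since no `O`-independent schedule fits the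
coin polynomial of every sub-exp iO (pad the coins of any iO by `ℓ^d`). In `Admissible'` the memberships
`C_b k ∈ ppolyCircuits (κ n)`, `κ n ≤ p(n)` and the `nm` bound already make the clear and obfuscated instances
poly-length, which is the drefute seat's repair for `stub_obfuscationMonotone` (there, standalone:
`∃ q, ∀ s, |genClear h m C nm s| ≤ q(|s|)`). -/

namespace Repaired

/-- (T-a)+(T-b)-repaired `BestPossibleStep`. -/
def BestPossibleStep' : Prop :=
  ∀ (ε : ℝ) (O : CircuitObfuscator), 0 < ε → IsSubexpIO ε ppolyCircuits O →
  ∀ (κ h : ℕ → ℕ) (m : List Bool → ℕ) (C₀ C₁ : (k : List Bool) → Circuit (Fin (m k)))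
    (nm ans : List Bool → List Bool),
    (∃ c : ℝ, 0 < c ∧ ∀ᶠ n : ℕ in atTop, (n : ℝ) ^ c ≤ κ n) →
    (∃ p : Polynomial ℕ, ∀ n, κ n ≤ p.eval n) → (∀ n, h n ≤ n) →
    (∃ p : Polynomial ℕ, ∀ s : List Bool,
        (nm (s.take (h s.length))).length ≤ p.eval s.length ∧
        (ans (s.take (h s.length))).length ≤ p.eval s.length) →
    (∀ s : List Bool,
        (⟨m (s.take (h s.length)), C₀ (s.take (h s.length))⟩ : SizedCircuit) ∈
            ppolyCircuits (κ s.length) ∧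
        (⟨m (s.take (h s.length)), C₁ (s.take (h s.length))⟩ : SizedCircuit) ∈
            ppolyCircuits (κ s.length) ∧
        (C₀ (s.take (h s.length))).size = (C₁ (s.take (h s.length))).size ∧
        (∀ x, (C₀ (s.take (h s.length))).eval x = (C₁ (s.take (h s.length))).eval x)) →
    (∃ n₀ : ℕ, ∀ s : List Bool, n₀ ≤ s.length →
        O.coins (κ s.length) (C₀ (s.take (h s.length))) ≤ s.length - h s.length ∧
        O.coins (κ s.length) (C₁ (s.take (h s.length))) ≤ s.length - h s.length) →
    ClauseC (genObf O κ h m C₁ nm) (keyed h ans) →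
    ClauseC (genObf O κ h m C₀ nm) (keyed h ans)

/-- (T-a)+(T-b)-repaired `LineData.Admissible` (to be used with an `O`-DEPENDENT datum `𝓛 O P f c`). -/
def Admissible' (𝓛 : LineData) (O : CircuitObfuscator) : Prop :=
  PolyTimeComputable Computability.unaryEncodeNat Computability.unaryEncodeNat 𝓛.κ ∧
  (∃ c : ℝ, 0 < c ∧ ∀ᶠ n : ℕ in atTop, (n : ℝ) ^ c ≤ 𝓛.κ n) ∧
  (∃ p : Polynomial ℕ, ∀ n, 𝓛.κ n ≤ p.eval n) ∧
  (∀ n, 𝓛.h n ≤ n) ∧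
  (∃ p : Polynomial ℕ, ∀ s : List Bool,
      (𝓛.nm (s.take (𝓛.h s.length))).length ≤ p.eval s.length ∧
      (𝓛.ans (s.take (𝓛.h s.length))).length ≤ p.eval s.length) ∧
  (∀ s : List Bool,
      (⟨𝓛.m (s.take (𝓛.h s.length)), 𝓛.C₀ (s.take (𝓛.h s.length))⟩ : SizedCircuit) ∈
          ppolyCircuits (𝓛.κ s.length) ∧
      (⟨𝓛.m (s.take (𝓛.h s.length)), 𝓛.C₁ (s.take (𝓛.h s.length))⟩ : SizedCircuit) ∈
          ppolyCircuits (𝓛.κ s.length) ∧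
      (𝓛.C₀ (s.take (𝓛.h s.length))).size = (𝓛.C₁ (s.take (𝓛.h s.length))).size ∧
      (∀ x, (𝓛.C₀ (s.take (𝓛.h s.length))).eval x = (𝓛.C₁ (s.take (𝓛.h s.length))).eval x)) ∧
  (∃ n₀ : ℕ, ∀ s : List Bool, n₀ ≤ s.length →
      O.coins (𝓛.κ s.length) (𝓛.C₀ (s.take (𝓛.h s.length))) ≤ s.length - 𝓛.h s.length ∧
      O.coins (𝓛.κ s.length) (𝓛.C₁ (s.take (𝓛.h s.length))) ≤ s.length - 𝓛.h s.length)

/-- Shape of the repaired bridge hypothesis: admissibility for every sub-exp iO with an `O`-dependent datum. -/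
def HadmRepaired (𝓛 : CircuitObfuscator → PuncturablePRFScheme → (List Bool → List Bool) → ℕ → LineData) :
    Prop :=
  ∀ ε : ℝ, 0 < ε → ε < 1 → ∀ O : CircuitObfuscator, IsSubexpIO ε ppolyCircuits O →
    ∀ P f c, Admissible' (𝓛 O P f c) O

end Repaired

end Targets

/-! ## §7 (cycle 4) The RESHAPED skeleton `Lines/knowledge_of_walk_split.lean` (sha `34fbd87f…`)

The lead's reshape (2026-08-16T05:20Z) answers §6 (T-a)/(T-b). Below: (7.1) a verbatim copy of the reshaped
`LineData.Admissible` and the check that it IMPLIES the disprover's `Repaired.Admissible'` of §6 (so the adopted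
repair subsumes the requested one; the `s = []` witness of §6 does not touch the eventual clause — nothing of §6
(T-b) applies to the reshaped bridge, whose datum is moreover `O`-dependent); (7.2) the walk model is FREE DATA:
for the EDGELESS model every coherent datum has `WordHard` vacuously and `KnowledgeOfWalk` false, so the line's
target `KnowledgeTransfer` is vacuous there and the route-level obligations `hcoh`/`hKW` carry meaning only for the
evaluating model (nbrs = run the instance's code) — a definitional obligation (fix `M := M_eval` in
`obfuscatedGluedTreesGen`), not a kill. (T8) and (T-d′) of the cycle-4 findings have no formal content (module
docstring). -/

namespace Targets

/-! ### (7.1) The reshaped admissibility predicate subsumes `Repaired.Admissible'` -/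

namespace Reshaped

/-- VERBATIM copy of the RESHAPED skeleton's `LineData.Admissible` (sha `34fbd87f…`): poly-length clear instances and
keyed answers (5th conjunct) and the EVENTUAL coin discipline (last conjunct). -/
def Admissible (𝓛 : LineData) (O : CircuitObfuscator) : Prop :=
  PolyTimeComputable Computability.unaryEncodeNat Computability.unaryEncodeNat 𝓛.κ ∧
  (∃ c : ℝ, 0 < c ∧ ∀ᶠ n : ℕ in atTop, (n : ℝ) ^ c ≤ 𝓛.κ n) ∧
  (∃ p : Polynomial ℕ, ∀ n, 𝓛.κ n ≤ p.eval n) ∧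
  (∀ n, 𝓛.h n ≤ n) ∧
  (∃ q : Polynomial ℕ, ∀ s : List Bool,
      (genClear 𝓛.h 𝓛.m 𝓛.C₀ 𝓛.nm s).length + (genClear 𝓛.h 𝓛.m 𝓛.C₁ 𝓛.nm s).length +
        (keyed 𝓛.h 𝓛.ans s).length ≤ q.eval s.length) ∧
  (∀ s : List Bool,
      (⟨𝓛.m (s.take (𝓛.h s.length)), 𝓛.C₀ (s.take (𝓛.h s.length))⟩ : SizedCircuit) ∈
          ppolyCircuits (𝓛.κ s.length) ∧
      (⟨𝓛.m (s.take (𝓛.h s.length)), 𝓛.C₁ (s.take (𝓛.h s.length))⟩ : SizedCircuit) ∈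
          ppolyCircuits (𝓛.κ s.length) ∧
      (𝓛.C₀ (s.take (𝓛.h s.length))).size = (𝓛.C₁ (s.take (𝓛.h s.length))).size ∧
      (∀ x, (𝓛.C₀ (s.take (𝓛.h s.length))).eval x = (𝓛.C₁ (s.take (𝓛.h s.length))).eval x)) ∧
  (∃ n₀ : ℕ, ∀ s : List Bool, n₀ ≤ s.length →
      O.coins (𝓛.κ s.length) (𝓛.C₀ (s.take (𝓛.h s.length))) ≤ s.length - 𝓛.h s.length ∧
      O.coins (𝓛.κ s.length) (𝓛.C₁ (s.take (𝓛.h s.length))) ≤ s.length - 𝓛.h s.length)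

/-- The entrance name is a suffix of the clear instance, hence not longer. -/
theorem length_nm_le_length_genClear (h : ℕ → ℕ) (m : List Bool → ℕ)
    (C : (k : List Bool) → Circuit (Fin (m k))) (nm : List Bool → List Bool) (s : List Bool) :
    (nm (s.take (h s.length))).length ≤ (genClear h m C nm s).length := by
  unfold genClear
  rw [length_boolPair]
  omega

/-- **The lead's reshaped `Admissible` implies the disprover's `Repaired.Admissible'`** (§6): the adopted repair
(poly-length clear instances + keyed answer, eventual coins) subsumes the requested one (poly-length names and
answers, eventual coins). -/
theorem admissible'_of_reshaped (𝓛 : LineData) (O : CircuitObfuscator) (h : Admissible 𝓛 O) :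
    Repaired.Admissible' 𝓛 O := by
  obtain ⟨hκ, hlo, hhi, hh, ⟨q, hq⟩, hpair, hcoins⟩ := h
  refine ⟨hκ, hlo, hhi, hh, ⟨q, fun s => ⟨?_, ?_⟩⟩, hpair, hcoins⟩
  · exact (length_nm_le_length_genClear 𝓛.h 𝓛.m 𝓛.C₀ 𝓛.nm s).trans (le_trans (by omega) (hq s))
  · have : (keyed 𝓛.h 𝓛.ans s).length ≤ q.eval s.length := le_trans (by omega) (hq s)
    simpa [keyed] using this

/-- In particular the `s = []` witness of §6 is gone: the reshaped predicate no longer forces a zero coin budget —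
it is satisfied at `s = []` by every obfuscator as soon as `n₀ ≥ 1` (the eventual clause is empty there). Stated as:
the eventual clause with threshold `n₀ = 1` holds at the empty seed whatever `O`. -/
theorem eventual_coinClause_nil (O : CircuitObfuscator) (κ h : ℕ → ℕ) (m : List Bool → ℕ)
    (C : (k : List Bool) → Circuit (Fin (m k))) :
    (1 : ℕ) ≤ ([] : List Bool).length →
      O.coins (κ ([] : List Bool).length) (C (([] : List Bool).take (h ([] : List Bool).length))) ≤
        ([] : List Bool).length - h ([] : List Bool).length := by
  intro h1
  simp at h1

end Reshaped

/-! ### (7.2) The walk model is free data: the edgeless model -/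

namespace WalkModel

/-- Copy of the skeleton's `WalkModel.endpoint` (execute a walk-word from the ENTRANCE; read right to left). -/
def endpoint (M : WalkModel) (x : List Bool) : List ℕ → Option (List Bool)
  | [] => some (M.entrance x)
  | i :: w => (endpoint M x w).bind fun cur => (M.nbrs x cur).bind fun l => l[i]?

/-- Copy of the skeleton's `WalkModel.IsValid`. -/
def IsValid (M : WalkModel) (x y : List Bool) : Prop := (M.nbrs x y).isSome = true

/-- Copy of the skeleton's `WalkModel.nameOf`. -/
def nameOf (M : WalkModel) (x y : List Bool) : List Bool := y.take (M.nameLen x)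

end WalkModel

/-- Copy of the skeleton's `inst`: the adversary's input `⟨1ⁿ, gen s⟩`. -/
def inst (gen : List Bool → List Bool) (n : ℕ) (s : List Bool) : List Bool :=
  boolPair (Computability.unaryEncodeNat n) (gen s)

/-- Copy of the (reshaped = original) skeleton's `KnowledgeOfWalk`. -/
def KnowledgeOfWalk (M : WalkModel) (gen : List Bool → List Bool) : Prop :=
  ∀ A : RandAlg (List Bool) (List Bool), IsPPT A id →
    ∃ E : List Bool → List ℕ, PolyTimeComputable id encodingListNatBool.encode E ∧
      SuperpolynomialDecay atTop (fun n : ℕ => (n : ℝ)) (fun n : ℕ =>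
        uniformAvg n fun s => uniformProb (A.coinLen (inst gen n s).length)
          {r | M.IsValid (gen s) (M.nameOf (gen s) (A.run (inst gen n s) r)) ∧
               M.nameOf (gen s) (A.run (inst gen n s) r) ≠ M.entrance (gen s) ∧
               M.endpoint (gen s) (E (boolPair (inst gen n s) r)) ≠
                 some (M.nameOf (gen s) (A.run (inst gen n s) r))})

/-- Copy of the skeleton's `WordHard`. -/
def WordHard (M : WalkModel) (gen ans : List Bool → List Bool) : Prop :=
  ∀ W : RandAlg (List Bool) (List ℕ), IsPPT W encodingListNatBool.encode →
    SuperpolynomialDecay atTop (fun n : ℕ => (n : ℝ)) (fun n : ℕ =>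
      uniformAvg n fun s => W.pr id (inst gen n s) {w | M.endpoint (gen s) w = some (ans s)})

/-- Copy of the skeleton's `Coherent`. -/
def Coherent (M : WalkModel) (gen ans : List Bool → List Bool) : Prop :=
  ∀ s, (ans s).length = M.nameLen (gen s) ∧ M.IsValid (gen s) (ans s) ∧ ans s ≠ M.entrance (gen s)

namespace Edgeless

/-- The EDGELESS walk model: every string is a valid name with the empty neighbour listing. -/
def edgeless (ent : List Bool → List Bool) (len : List Bool → ℕ) : WalkModel :=
  ⟨ent, len, fun _ _ => some []⟩

variable (ent : List Bool → List Bool) (len : List Bool → ℕ)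

/-- In the edgeless model only the empty word has an endpoint (the ENTRANCE). -/
theorem endpoint_edgeless (x : List Bool) (w : List ℕ) :
    (edgeless ent len).endpoint x w = if w = [] then some (ent x) else none := by
  cases w with
  | nil => rfl
  | cons i w =>
    simp only [WalkModel.endpoint, reduceCtorEq, ↓reduceIte]
    cases WalkModel.endpoint (edgeless ent len) x w with
    | none => rfl
    | some cur => simp [edgeless]

/-- Every string is valid in the edgeless model. -/
theorem isValid_edgeless (x y : List Bool) : (edgeless ent len).IsValid x y := rfl

/-- **`WordHard` is VACUOUS in the edgeless model** as soon as the answer is never the entrance (one third of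
`Coherent`): no word ends at the answer, the event is empty, every word finder has success `0`. -/
theorem wordHard_edgeless (gen ans : List Bool → List Bool) (hne : ∀ s, ans s ≠ ent (gen s)) :
    WordHard (edgeless ent len) gen ans := by
  intro W _
  have hempty : ∀ s, {w : List ℕ | (edgeless ent len).endpoint (gen s) w = some (ans s)} = ∅ := by
    intro s
    ext w
    simp only [Set.mem_setOf_eq, Set.mem_empty_iff_false, iff_false, endpoint_edgeless]
    split_ifs with hw
    · exact fun h => hne s (Option.some_injective _ h).symm
    · simp
  have hzero : (fun n : ℕ => uniformAvg n fun s =>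
      W.pr id (inst gen n s) {w | (edgeless ent len).endpoint (gen s) w = some (ans s)}) = fun _ => 0 := by
    funext n
    simp [hempty, RandAlg.pr, uniformAvg]
  rw [hzero]
  exact superpolynomialDecay_zero _ _

/-- `Coherent` data have `WordHard` for free in the edgeless model. -/
theorem wordHard_edgeless_of_coherent (gen ans : List Bool → List Bool)
    (hcoh : Coherent (edgeless ent len) gen ans) : WordHard (edgeless ent len) gen ans :=
  wordHard_edgeless ent len gen ans fun s => (hcoh s).2.2

/-- A sequence that is `1` frequently does not decay superpolynomially. -/
theorem not_superpolynomialDecay_of_frequently_eq_one {f : ℕ → ℝ}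
    (h : ∃ᶠ n in atTop, f n = 1) : ¬ SuperpolynomialDecay atTop (fun n : ℕ => (n : ℝ)) f := by
  intro hdec
  have htend : Tendsto f atTop (nhds 0) := by simpa using hdec 0
  have hev : ∀ᶠ n : ℕ in atTop, f n < 1 :=
    htend.eventually (gt_mem_nhds (by norm_num : (0 : ℝ) < 1))
  obtain ⟨n, hn, hlt⟩ := (h.and_eventually hev).exists
  rw [hn] at hlt
  exact lt_irrefl _ hlt

/-- `uniformProb` of an event containing every string of the sampled length is `1`. -/
theorem uniformProb_eq_one_of_forall {m : ℕ} {E : Set (List Bool)}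
    (h : ∀ r : List Bool, r.length = m → r ∈ E) : uniformProb m E = 1 := by
  classical
  unfold uniformProb
  rw [Finset.filter_true_of_mem fun (r : List.Vector Bool m) _ => h r.toList (by simp)]
  simp [card_vector]

/-- **`KnowledgeOfWalk` is FALSE in the edgeless model** whenever the entrance name is non-empty on all seeds of
infinitely many lengths: the constant adversary `[]` outputs a valid (everything is valid) non-entrance name part
(`[]`) that no word reaches (only the entrance is reachable), whatever the extractor. -/
theorem not_knowledgeOfWalk_edgeless (gen : List Bool → List Bool)
    (hent : ∃ᶠ n in atTop, ∀ s : List Bool, s.length = n → ent (gen s) ≠ []) :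
    ¬ KnowledgeOfWalk (edgeless ent len) gen := by
  classical
  intro hK
  have hPPT : IsPPT (RandAlg.ofDet fun _ : List Bool => ([] : List Bool)) id :=
    RandAlg.IsPolyTime.ofDet_holds (PolyTimeComputable.const _ _ [])
  obtain ⟨E, -, hdec⟩ := hK (RandAlg.ofDet fun _ => ([] : List Bool)) hPPT
  refine not_superpolynomialDecay_of_frequently_eq_one ?_ hdec
  refine hent.mono fun n hn => ?_
  have hname : ∀ x : List Bool, (edgeless ent len).nameOf x ([] : List Bool) = [] := fun x => by
    simp [WalkModel.nameOf]
  have hone : ∀ s : List Bool, s.length = n →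
      uniformProb ((RandAlg.ofDet fun _ : List Bool => ([] : List Bool)).coinLen (inst gen n s).length)
        {r | (edgeless ent len).IsValid (gen s)
              ((edgeless ent len).nameOf (gen s) ((RandAlg.ofDet fun _ : List Bool => ([] : List Bool)).run
                (inst gen n s) r)) ∧
             (edgeless ent len).nameOf (gen s) ((RandAlg.ofDet fun _ : List Bool => ([] : List Bool)).run
                (inst gen n s) r) ≠ (edgeless ent len).entrance (gen s) ∧
             (edgeless ent len).endpoint (gen s) (E (boolPair (inst gen n s) r)) ≠
               some ((edgeless ent len).nameOf (gen s)
                 ((RandAlg.ofDet fun _ : List Bool => ([] : List Bool)).run (inst gen n s) r))} = 1 := by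
    intro s hs
    refine uniformProb_eq_one_of_forall fun r _ => ?_
    simp only [Set.mem_setOf_eq, RandAlg.ofDet, hname]
    refine ⟨isValid_edgeless ent len _ _, fun h => hn s hs h.symm, ?_⟩
    rw [endpoint_edgeless]
    split_ifs
    · exact fun h => hn s hs (Option.some_injective _ h)
    · simp
  simp only [uniformAvg]
  rw [Finset.sum_congr rfl fun (x : List.Vector Bool n) _ => hone x.toList (by simp)]
  simp [card_vector]

/-- **Hence the line's antecedent triple is unsatisfiable in the edgeless model** (for entrance names non-empty
frequently): `Coherent ∧ KnowledgeOfWalk` already fails, and `KnowledgeTransfer` holds there vacuously — the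
antecedents, and the route-level obligations `hcoh`/`hKW`, mean something only for the evaluating walk model. -/
theorem antecedents_false_edgeless (gen ans : List Bool → List Bool)
    (hent : ∃ᶠ n in atTop, ∀ s : List Bool, s.length = n → ent (gen s) ≠ []) :
    ¬ (Coherent (edgeless ent len) gen ans ∧ KnowledgeOfWalk (edgeless ent len) gen ∧
        WordHard (edgeless ent len) gen ans) :=
  fun h => not_knowledgeOfWalk_edgeless ent len gen hent h.2.1

end Edgeless

end Targets

/-! ## §4 Remarks without formal content (strengthenings, regimes, near-misses)

* "(C) for every functionality-preserving obfuscator" (iO security DROPPED) is false: the identity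
  obfuscator hands `N_k` with `k` in the clear and `name_k(EXIT) = Enc_k(label EXIT)` is one PRF
  evaluation away. (Not formalised: needs the concrete `N_k` and a PPT parser in the TM2 model.)
* "(C) with `2^{λ^ε}` replaced by polynomial security": truth unknown either way (BPR/GPS need
  sub-exponential or functional-encryption-based polynomial chains, GPS16/GargEtAl2017); no attack.
* Seed budget (T2): `s ∈ {0,1}ⁿ` cannot hold keys of length `λ = n^c`, `c > 1`; repair
  `depth d = ⌊n^{1/a}⌋`, `λ ≤ n`; then Thm 9 gives success `≤ 4·2^{-d/6}` for `2^{d/6}` queries, still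
  negligible in `n`. A typing repair, not a kill.
* Public cycle `σ` (pseudorandomness of the glue DROPPED): 4-cycles `parent–leaf–leaf'–sibling` make
  the leaf level and the orientation just above it detectable, but climbing to depth `j` of the EXIT
  tree still needs `≈ 2^{n-j}` look-ahead evaluations per level; no polynomial attack found, so this
  hypothesis is load-bearing for the CCDFGS PROOF (random embedding) but no kill of the mutant is
  claimed.
* One-iO-to-all-iO transfer (informal): if a PPT `A` finds EXIT on `(O(N_k), name E)` with
  probability `p(n)` for ONE sub-exp iO `O` and padding size `S ≥ |O'(N_k)|`, then
  `A ∘ O ∘ pad_S` finds EXIT on `(O'(N_k), name E)` with probability `≥ p(n) − δ` for every iO `O'`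
  (apply `O`'s security to the equivalent same-size pair `pad_S N_k`, `pad_S O'(N_k)`; the
  distinguisher runs `A` and the public EXIT test `Graph.degree_eq_two_iff`). Hence "refutable for
  some iO" = "refutable for all iO" = a universal white-box EXIT-finder; none is known, and in the
  pseudorandom-oracle model (ideal obfuscation exists, JLLW 2023) none exists. This is WHY the crux
  resists disproof; the percolation lemma of §3 is why it resists PROOF by the only named template.
* (cycle 2) QUANTIFIER-ORDER OBLIGATION for every keyed hybrid step, the transfer above included. The
  tree's `CircuitObfuscator.IsSecureIndistinguishable` fixes the distinguisher `D` and its advice `a`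
  BEFORE the universally quantified pair `(C₀, C₁)` and hands `D` only `(a κ, 1^κ, code of O(C_b))` —
  no `k`, no `name_k(ENTRANCE)`. A step comparing `O(C₀^k)` with `O(C₁^k)` on average over the key
  `k` is obtained by the WORST-CASE-KEY ADVICE trick: `D` := "parse the advice as `(k, e)`, run `A` on
  `(challenge, e)`, apply the public test"; `a κ := (k*, name_{k*}(ENTRANCE))` for a key `k*`
  maximising the gap at `κ` (length `poly(κ) ≤ 2^{κ^ε}`); then `avg_k gap_k ≤ max_k gap_k =
  gap_{k*} ≤ δ κ`. So non-uniformity is USED essentially (a uniform-distinguisher iO notion would not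
  support keyed hybrids with key-dependent auxiliary input such as `name_k(ENTRANCE)`), and the
  security parameter fed to `O` must be `κ ≥ |pad_s N_k|` for the pair to lie in `ppolyCircuits κ`.
* (cycle 3) THE GADGET BOUNDARY — why contrived obfuscators kill `∀O`-knowledge statements but NOT the
  crux. A "gadget" iO `O*(C) := O(C) +` dead code `O(T_C)` (TRIAGE-r1-3) stays a sub-exp iO exactly when
  the planted circuit family `C ↦ T_C` is (i) poly-size and efficiently computable from the circuit `C`, and
  (ii) CLASS-INVARIANT: `T_{C₀} ≡ T_{C₁}` (same size) whenever `C₀ ≡ C₁` — then the two-step hybrid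
  `O(C₀)→O(C₁)`, `O(T_{C₀})→O(T_{C₁})` with worst-case samples as advice applies (§4, cycle 2). Using `C` as
  a BLACK BOX inside `T_C` (hidden pseudorandom walks, …) is the available supply of class-invariant
  functionals. A TRAPDOOR gadget (parse `k` out of the canonical `N_k`; plant `name_k(EXIT)`, or the mirror
  map `Enc_k ∘ flip ∘ Dec_k`) is NOT class-invariant: on a non-canonical `C₁ ≡ N_k` the obfuscator cannot
  reproduce it (that would be a universal white-box EXIT-finder), and the keyed distinguisher — whose advice
  may hold the worst-case key `k*` itself, hence `name_{k*}(ENTRANCE)` and the public degree-2 test — tells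
  the two outputs apart; such an `O*` is no iO. So what any contrived iO hands the adversary for free is the
  output of an efficiently computable class-invariant functional on adversary-known inputs; for the
  black-box supply, ChildsEtAl2003 Thm 9 (tree: `ChildsEtAl2003_thm9_holds`) bounds the chance of reaching
  EXIT from `name(ENTRANCE)` by `4·2^{-d/6}`; a non-black-box class-invariant EXIT-locator would itself be the
  universal white-box EXIT-finder of §4. Hence no gadget obfuscator refutes clause (C), while gadgets DO
  refute every `∀O`-typed claim asserting hardness of a black-box-EASY task (hidden-walk endpoints:
  `∀O`-KWA; "no PPT outputs a valid deep name"). Rule of thumb for planners: an `∀O` statement survives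
  gadgets iff its hard task is already hard for poly-query ORACLE algorithms given the adversary's inputs.
* (cycle 3) Literature: Goldwasser–Rothblum, *On best-possible obfuscation* (TCC 2007 / J. Cryptology
  2013, doi:10.1007/s00145-013-9151-z, read pp. 12–14): Prop. 5 (efficient iO ⇒ best-possible, against
  poly learners; "the efficiency of the indistinguishability obfuscator is essential"), Thm. 1 / Cor. 1
  (statistically best-possible, resp. efficient statistically-iO, already for 3-CNF ⇒ PH = Σ₂) — the
  in-print anchors of (T-a): best-possible-ness is relative to the adversary class, and "every sub-exp iO
  hides dead code statistically" is no rescue. searchd still degraded (local FTS "unable to open database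
  file"; OpenAlex 429; crossref only).
* (cycle 2) Literature: searchd unreachable (rc 75, twice); galaxy/pdf "intelligent" sweep (25 hits)
  found no white-box / iO treatment of glued-trees traversal and no classical attack on succinct
  glued trees; nearest: Childs–Coudron–Gilani 2023 ("power of forgetting": PATH-finding is hard for
  genuine rooted algorithms — orthogonal to EXIT-finding), BitanskyDegwekarVaikuntanathan2016 /
  AsharovSegev2015 (limits of iO for structured hardness — do not cover traversal, cf. ideator-2 §E1),
  HohenbergerSahaiWaters2014 (replacing a random oracle by iO for FDH — an RO-instantiation precedent
  for a different task). Aaronson arXiv:2209.06930 p.9 (instantiation open) stands.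
-/

end Summit.QuantumAdvantage.QuantumAdvantage.Cruxes.WbwObfuscatedGluedTrees.Disproof
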